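import Literature.NumberTheory.NumberFields.CyclicCubicField13Model
import Literature.NumberTheory.EllipticCurves.TwoDescentParity
import Mathlib.NumberTheory.Padics.PadicVal.Basic
import HarnessLib

/-!
# The cyclic cubic field of conductor `13`: the norm-`1` `2`-descent of `480a1` over `K`

Let `K = ℚ(θ)`, `θ³ + θ² - 4θ + 1 = 0`, be the cyclic cubic field of conductor `13`
(`CyclicCubicField13.lean`: `𝓞 K = ℤ[θ]`, units `θ`, `θ - 1`, real signs; `CyclicCubicField13Primes.lean`:
`2`, `3` inert, `5 = 𝔭₋₁𝔭₂𝔭₋₂` with `𝔭_c = (θ - c)`, class number `1`;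
`CyclicCubicField13Model.lean`: the quotient `𝓞 K/8` as the computable ring `CubicAlg (ZMod 8)` and
three exhaustive finite checks). The main result of this file is

* `normDescent`: if `(x, y) ∈ K²` satisfies `y² = x(x+2)(x-3)` with `y ≠ 0` and both `N_{K/ℚ}(x)` and
  `N_{K/ℚ}(x+2)` are squares in `ℚ`, then `x` and `x + 2` are squares in `K`.

In other words, the norm-`1` part of the image of the complete `2`-descent map
`P ↦ (x - e₁, x - e₂) ∈ K(S,2)²` [SilvermanAEC2009, Ch. X §1, Prop. X.1.4] of the elliptic curve
`480a1 : y² = x(x+2)(x-3)` over `K` is trivial outside the `2`-torsion; combined with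
`Literature.Barriers.BirchSwinnertonDyer.DokchitserDokchitser2011_rank_480a1_F3_of_cubic_normDescent`
this is the statement `rk 480a1(K) = rk 480a1(ℚ) = 0` for the conductor-`13` subfield of the field `F₃`
of [DokchitserDokchitser2011RankModN, proof of Thm. 2] (where the ranks are obtained by a Magma
`2`-descent over the minimal subfields of `F₃`). The argument formalized here is the classical
hand computation, in the following steps (all [folklore] given the cited method).

1. *Even valuations.* From the curve equation the classes of `x`, `x+2` have even valuation away from
   the primes dividing the differences `e_i - e_j ∈ {±2, ±3, ±5}` (`Literature.NumberTheory.EllipticCurves.TwoDescentParity`); at the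
   inert primes `(2)`, `(3)` evenness follows from the norm hypothesis, because a `σ`-invariant
   valuation takes the same value on the three conjugates (`two_dvd_log_valuation_of_isSquare_norm`).
2. *Representatives.* Since `h(K) = 1` and `𝓞ˣ/𝓞ˣ² = ⟨-1, θ, θ-1⟩` (`exists_eq_rep_mul_sq`), we get
   `x = u A²` and `x + 2 = u' (θ+1)^{k₁} (θ-2)^{k₂} (θ+2)^{k₃} B²` with `u, u'` among the eight unit
   representatives and `k_c ∈ {0,1}` (`exists_rep_mul_sq_x`, `exists_rep_mul_prod_mul_sq_x_add_two`);
   the norm conditions force `u, u'` into the norm-`1` classes `{1, θ-1, -θ, -θ(θ-1)}` (`norm_rep`,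
   `N(θ - c) = -5`).
3. *Real places.* `x + 2` is totally positive (`y² = x(x+2)(x-3)` over `ℝ` forces `x + 2 > 0`:
   `real_x_add_two_pos`), which leaves four sign-compatible combinations `(u', k)` (`real_survivors`,
   a `decide` over `SignType³` using the signs of `θ`, `θ-1`, `θ-c` at the three real embeddings).
4. *The prime `2`.* Reducing `x = αA²`, `x + 2 = βB²`, `x - 3 = αβC²` modulo `8` after clearing odd
   denominators (`exists_odd_int_mul_eq`: a `2`-adic unit of `K` is `w/d` with `w ∈ 𝓞 K ∖ (2)` and
   `d ∈ ℤ` odd, using `N(s) = s σ(s) σ²(s)`), and splitting according to `v₂(A) <, =, > 1`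
   (`two_adic_obstruction`, cores `core_n0/n1/n2`), the finite checks `no_solution_n0/n1/n2` of
   `CyclicCubicField13Model.lean` exclude every candidate with `α = u ≠ 1`; hence `x = A²`.
5. *The primes above `5`.* `A² + 2` has even order at each `𝔭_c` (`two_dvd_log_valuation_sq_add_two`:
   `a² + 2b² ≠ 0` in `𝔽₅` for `b ≠ 0`), so `k = 0`, and then step 3 gives `u' = 1`: `x + 2 = B²`.

## Contents

`v₂`, `v₃`, `v₅ hc` (the primes as points of the height-one spectrum), `σint` (`σ` on `𝓞 K`) and the
invariance `valuation_σ_eq` of inert valuations, `sgn3` (sign vector at the real places), the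
`2`-adic section (`exists_odd_int_mul_eq`, `two_adic_obstruction`), the assembly `normDescent`,
and its transport `normDescent_of_root` to ANY cubic extension `K'/ℚ` containing a root `θ'` of
`f` (`algEquivOfRoot : K ≃ₐ[ℚ] K'`, `θ ↦ θ'`) — the form in which the field occurs as a subfield
of `ℚ(ζ₁₃₃₉)`. No named facts are introduced.
-/

noncomputable section

open Polynomial NumberField Algebra Ideal IsDedekindDomain IsDedekindDomain.HeightOneSpectrum
open scoped WithZero

namespace Literature.NumberTheory.NumberFields

namespace CyclicCubic13

/-! ### Primes of `𝓞 K` containing a rational prime, as points of `HeightOneSpectrum` -/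

/-- A prime `P` of `𝓞 K` containing the rational prime `p` lies over `(p) ⊂ ℤ`. [folklore] -/
theorem mem_primesOver_of_mem {p : ℕ} (hp : p.Prime) {P : Ideal (𝓞 K)} [hP : P.IsPrime]
    (hmem : (p : 𝓞 K) ∈ P) : P ∈ primesOver (span {(p : ℤ)}) (𝓞 K) := by
  haveI : Fact p.Prime := ⟨hp⟩
  refine ⟨hP, ⟨?_⟩⟩
  refine (Int.ideal_span_isMaximal_of_prime p).eq_of_le (Ideal.comap_ne_top _ hP.ne_top) ?_
  rw [Ideal.span_singleton_le_iff_mem, Ideal.mem_comap, map_natCast]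
  exact hmem

/-- **The prime `v₂ = (2)`** of `𝓞 K` as a point of the height-one spectrum. [folklore] -/
def v₂ : HeightOneSpectrum (𝓞 K) := ⟨span {(2 : 𝓞 K)}, span_two.1, by
  rw [Ne, span_singleton_eq_bot]; norm_num⟩

/-- **The prime `v₃ = (3)`**. [folklore] -/
def v₃ : HeightOneSpectrum (𝓞 K) := ⟨span {(3 : 𝓞 K)}, span_three.1, by
  rw [Ne, span_singleton_eq_bot]; norm_num⟩

/-- `θ - c ≠ 0` in `𝓞 K` for `c = -1, 2, -2` (the ideal it generates has norm `5`). [folklore] -/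
theorem θint_sub_ne_zero {c : ℤ} (hc : c = -1 ∨ c = 2 ∨ c = -2) : (θint - c : 𝓞 K) ≠ 0 := by
  intro h
  have h5 := (isPrime_span_θint_sub hc).2
  rw [h, show span {(0 : 𝓞 K)} = ⊥ from span_singleton_eq_bot.mpr rfl, Ideal.absNorm_bot] at h5
  exact absurd h5 (by norm_num)

/-- **The primes `v₅(c) = (θ - c)` above `5`**, `c ∈ {-1, 2, -2}`. [folklore] -/
def v₅ {c : ℤ} (hc : c = -1 ∨ c = 2 ∨ c = -2) : HeightOneSpectrum (𝓞 K) :=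
  ⟨span {(θint - c : 𝓞 K)}, (isPrime_span_θint_sub hc).1, by
    rw [Ne, span_singleton_eq_bot]; exact θint_sub_ne_zero hc⟩

/-- A point of the height-one spectrum containing `2` is `v₂`. [folklore] -/
theorem eq_v₂_of_mem {v : HeightOneSpectrum (𝓞 K)} (h : (2 : 𝓞 K) ∈ v.asIdeal) : v = v₂ := by
  haveI := v.isPrime
  have := span_two.2.2 v.asIdeal (by simpa using mem_primesOver_of_mem Nat.prime_two (by simpa using h))
  exact HeightOneSpectrum.ext this

/-- A point of the height-one spectrum containing `3` is `v₃`. [folklore] -/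
theorem eq_v₃_of_mem {v : HeightOneSpectrum (𝓞 K)} (h : (3 : 𝓞 K) ∈ v.asIdeal) : v = v₃ := by
  haveI := v.isPrime
  have := span_three.2.2 v.asIdeal (by simpa using mem_primesOver_of_mem Nat.prime_three (by simpa using h))
  exact HeightOneSpectrum.ext this

/-- A point of the height-one spectrum containing `5` is one of the three `v₅(c)`. [folklore] -/
theorem eq_v₅_of_mem {v : HeightOneSpectrum (𝓞 K)} (h : (5 : 𝓞 K) ∈ v.asIdeal) :
    v = v₅ (Or.inl rfl) ∨ v = v₅ (Or.inr (Or.inl rfl)) ∨ v = v₅ (Or.inr (Or.inr rfl)) := by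
  haveI := v.isPrime
  have hP : v.asIdeal ∈ primesOver (span {(5 : ℤ)}) (𝓞 K) := by
    simpa using mem_primesOver_of_mem Nat.prime_five (by simpa using h)
  rcases eq_of_mem_primesOver_five hP with h1 | h2 | h3
  · refine Or.inl (HeightOneSpectrum.ext ?_); rw [h1]; change _ = span {θint - ((-1 : ℤ) : 𝓞 K)}; push_cast; rw [sub_neg_eq_add]
  · refine Or.inr (Or.inl (HeightOneSpectrum.ext ?_)); rw [h2]; change _ = span {θint - ((2 : ℤ) : 𝓞 K)}; push_cast; rfl
  · refine Or.inr (Or.inr (HeightOneSpectrum.ext ?_)); rw [h3]; change _ = span {θint - ((-2 : ℤ) : 𝓞 K)}; push_cast; rw [sub_neg_eq_add]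

/-- **Valuations of rational integers**: for a natural number `n` and a finite place `v` of `K`,
`v(n) = 1` unless `n ∈ v` (then `v(n) < 1`); always `v(n) ≤ 1`. [folklore] -/
theorem valuation_natCast_eq_one_iff (v : HeightOneSpectrum (𝓞 K)) (n : ℕ) :
    v.valuation K (n : K) = 1 ↔ (n : 𝓞 K) ∉ v.asIdeal := by
  rw [show (n : K) = algebraMap (𝓞 K) K n by simp, valuation_of_algebraMap, intValuation_eq_one_iff]

/-- `v(n) ≤ 1` for a natural number `n`. [folklore] -/
theorem valuation_natCast_le_one (v : HeightOneSpectrum (𝓞 K)) (n : ℕ) : v.valuation K (n : K) ≤ 1 := by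
  rw [show (n : K) = algebraMap (𝓞 K) K n by simp]; exact valuation_le_one v _

/-! ### `σ` on `𝓞 K` and the invariance of the inert valuations -/

/-- **`σ` restricted to `𝓞 K`** (a ring automorphism). [folklore] -/
def σint : 𝓞 K ≃+* 𝓞 K := RingOfIntegers.mapRingEquiv σ.toRingEquiv

/-- `σint` is `σ` on `K`. [folklore] -/
@[simp] theorem coe_σint (a : 𝓞 K) : ((σint a : 𝓞 K) : K) = σ (a : K) := rfl

/-- **A ring automorphism of `𝓞 K` preserves the valuation at an inert prime `(p)`**: it
preserves divisibility by `pⁿ`, and `v_{(p)}(a) ≤ exp(-n) ↔ pⁿ ∣ a`. [folklore] -/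
theorem intValuation_ringEquiv_le (v : HeightOneSpectrum (𝓞 K)) {p : ℕ} (hv : v.asIdeal = span {(p : 𝓞 K)})
    (τ : 𝓞 K ≃+* 𝓞 K) (a : 𝓞 K) : v.intValuation (τ a) ≤ v.intValuation a := by
  by_cases ha : a = 0
  · simp [ha]
  have key : ∀ (b : 𝓞 K) (n : ℕ), v.intValuation b ≤ WithZero.exp (-(n : ℤ)) ↔ (p : 𝓞 K) ^ n ∣ b := by
    intro b n
    rw [intValuation_le_pow_iff_dvd, hv, Ideal.span_singleton_pow, dvd_span_singleton,
      Ideal.mem_span_singleton]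
  -- write `v a = exp (-m)`
  have hva : v.intValuation a ≠ 0 := intValuation_ne_zero v a ha
  obtain ⟨m, hm⟩ : ∃ m : ℕ, v.intValuation a = WithZero.exp (-(m : ℤ)) := by
    have hle : WithZero.log (v.intValuation a) ≤ 0 := by
      rw [← WithZero.log_one]
      exact (WithZero.log_le_log hva one_ne_zero).mpr (intValuation_le_one v a)
    refine ⟨(-WithZero.log (v.intValuation a)).toNat, ?_⟩
    rw [Int.toNat_of_nonneg (by omega), neg_neg, WithZero.exp_log hva]
  rw [hm, key]
  have h := (key a m).mp hm.le
  simpa using map_dvd τ h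

/-- Hence `v_{(p)}(τ a) = v_{(p)}(a)` for a ring automorphism `τ` of `𝓞 K` and an inert `p`.
[folklore] -/
theorem intValuation_ringEquiv_eq (v : HeightOneSpectrum (𝓞 K)) {p : ℕ} (hv : v.asIdeal = span {(p : 𝓞 K)})
    (τ : 𝓞 K ≃+* 𝓞 K) (a : 𝓞 K) : v.intValuation (τ a) = v.intValuation a := by
  refine le_antisymm (intValuation_ringEquiv_le v hv τ a) ?_
  have := intValuation_ringEquiv_le v hv τ.symm (τ a)
  rwa [τ.symm_apply_apply] at this

/-- **`σ` preserves the valuation of `K` at an inert prime `(p)`.** [folklore] -/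
theorem valuation_σ_eq (v : HeightOneSpectrum (𝓞 K)) {p : ℕ} (hv : v.asIdeal = span {(p : 𝓞 K)}) (z : K) :
    v.valuation K (σ z) = v.valuation K z := by
  obtain ⟨a, b, hb, rfl⟩ := IsFractionRing.div_surjective (A := 𝓞 K) z
  have e : σ (algebraMap (𝓞 K) K a / algebraMap (𝓞 K) K b) =
      algebraMap (𝓞 K) K (σint a) / algebraMap (𝓞 K) K (σint b) := by
    rw [map_div₀]; rfl
  rw [e, map_div₀, map_div₀, valuation_of_algebraMap, valuation_of_algebraMap, valuation_of_algebraMap,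
    valuation_of_algebraMap, intValuation_ringEquiv_eq v hv, intValuation_ringEquiv_eq v hv]

/-- **Norm parity at an inert prime**: if `N_{K/ℚ}(z)` is the square of a rational number then
`ord_{(p)}(z)` is even, for `p = 2, 3` inert in `K`: `N(z) = z·σz·σ²z` has
`ord_{(p)}(N z) = 3 ord_{(p)}(z)` and `ord_{(p)}(r²) = 2 ord_{(p)}(r)`. [folklore] -/
theorem two_dvd_log_valuation_of_isSquare_norm (v : HeightOneSpectrum (𝓞 K)) {p : ℕ}
    (hv : v.asIdeal = span {(p : 𝓞 K)}) {z : K} (hz : z ≠ 0) (h : IsSquare (Algebra.norm ℚ z)) :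
    (2 : ℤ) ∣ WithZero.log (v.valuation K z) := by
  obtain ⟨r, hr⟩ := h
  have hN := norm_eq_mul_σ_mul_σσ z
  rw [hr, map_mul] at hN
  have hz1 : σ z ≠ 0 := (map_ne_zero σ).mpr hz
  have hz2 : σ (σ z) ≠ 0 := (map_ne_zero σ).mpr hz1
  have hr0 : (algebraMap ℚ K r) ≠ 0 := by
    intro h0
    rw [h0, zero_mul] at hN
    exact mul_ne_zero (mul_ne_zero hz hz1) hz2 hN.symm
  have hv0 : v.valuation K z ≠ 0 := (Valuation.ne_zero_iff _).mpr hz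
  have hvr : v.valuation K (algebraMap ℚ K r) ≠ 0 := (Valuation.ne_zero_iff _).mpr hr0
  have key : WithZero.log (v.valuation K (algebraMap ℚ K r * algebraMap ℚ K r)) =
      WithZero.log (v.valuation K (z * σ z * σ (σ z))) := by rw [hN]
  rw [map_mul, map_mul, map_mul, WithZero.log_mul hvr hvr,
    WithZero.log_mul (mul_ne_zero hv0 ((Valuation.ne_zero_iff _).mpr hz1)) ((Valuation.ne_zero_iff _).mpr hz2),
    WithZero.log_mul hv0 ((Valuation.ne_zero_iff _).mpr hz1), valuation_σ_eq v hv, valuation_σ_eq v hv,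
    valuation_σ_eq v hv] at key
  exact ⟨WithZero.log (v.valuation K (algebraMap ℚ K r)) - WithZero.log (v.valuation K z), by linarith⟩

/-! ### Valuations of the generators `θ - c` of the primes above `5` -/

/-- `(θ - c : K)` is the image of `θint - c ∈ 𝓞 K`. [folklore] -/
theorem coe_θint_sub (c : ℤ) : ((θint - c : 𝓞 K) : K) = θ - c := by
  rw [RingOfIntegers.coe_eq_algebraMap, map_sub, map_intCast, show algebraMap (𝓞 K) K θint = θ from rfl]

/-- `ord_{(θ - c)}(θ - c) = 1`: `log v₅(c)(θ - c) = -1`. [folklore] -/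
theorem log_valuation_v₅_self {c : ℤ} (hc : c = -1 ∨ c = 2 ∨ c = -2) :
    WithZero.log ((v₅ hc).valuation K (θ - c)) = -1 := by
  rw [← coe_θint_sub, show (((θint - c : 𝓞 K)) : K) = algebraMap (𝓞 K) K (θint - c) from rfl,
    valuation_of_algebraMap, (v₅ hc).intValuation_singleton (θint_sub_ne_zero hc) rfl, WithZero.log_exp]

/-- The ideal `(θ - c)` is maximal (`c = -1, 2, -2`). [folklore] -/
theorem isMaximal_span_θint_sub {c : ℤ} (hc : c = -1 ∨ c = 2 ∨ c = -2) :
    (span {(θint - c : 𝓞 K)}).IsMaximal :=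
  (isPrime_span_θint_sub hc).1.isMaximal (by rw [Ne, span_singleton_eq_bot]; exact θint_sub_ne_zero hc)

/-- `θ - c' ∉ (θ - c)` for distinct `c, c' ∈ {-1, 2, -2}` (the three primes above `5` are
distinct). [folklore] -/
theorem θint_sub_not_mem {c c' : ℤ} (hc : c = -1 ∨ c = 2 ∨ c = -2) (hc' : c' = -1 ∨ c' = 2 ∨ c' = -2)
    (hne : c ≠ c') : (θint - c' : 𝓞 K) ∉ span {(θint - c : 𝓞 K)} := by
  intro hmem
  have hle : span {(θint - c' : 𝓞 K)} ≤ span {(θint - c : 𝓞 K)} := (span_singleton_le_iff_mem _).mpr hmem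
  have heq := (isMaximal_span_θint_sub hc').eq_of_le (isMaximal_span_θint_sub hc).ne_top hle
  obtain ⟨h12, h13, h23⟩ := span_θint_sub_ne
  rcases hc with rfl | rfl | rfl <;> rcases hc' with rfl | rfl | rfl <;> push_cast at heq hne <;>
    simp only [sub_neg_eq_add] at heq <;>
    first
      | exact hne rfl
      | exact h12 heq
      | exact h12 heq.symm
      | exact h13 heq
      | exact h13 heq.symm
      | exact h23 heq
      | exact h23 heq.symm

/-- `v₅(c)(θ - c') = 1` for `c ≠ c'`. [folklore] -/
theorem valuation_v₅_other {c c' : ℤ} (hc : c = -1 ∨ c = 2 ∨ c = -2) (hc' : c' = -1 ∨ c' = 2 ∨ c' = -2)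
    (hne : c ≠ c') : (v₅ hc).valuation K (θ - c') = 1 := by
  rw [← coe_θint_sub, show (((θint - c' : 𝓞 K)) : K) = algebraMap (𝓞 K) K (θint - c') from rfl,
    valuation_of_algebraMap, intValuation_eq_one_iff]
  exact θint_sub_not_mem hc hc' hne

/-- `v(θ - c) = 1` at every finite place `v` not above `5`. [folklore] -/
theorem valuation_θ_sub_eq_one {v : HeightOneSpectrum (𝓞 K)} (h5 : (5 : 𝓞 K) ∉ v.asIdeal) {c : ℤ}
    (hc : c = -1 ∨ c = 2 ∨ c = -2) : v.valuation K (θ - c) = 1 := by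
  rw [← coe_θint_sub, show (((θint - c : 𝓞 K)) : K) = algebraMap (𝓞 K) K (θint - c) from rfl,
    valuation_of_algebraMap, intValuation_eq_one_iff]
  intro hmem
  apply h5
  have hle : span {(θint - c : 𝓞 K)} ≤ v.asIdeal := (span_singleton_le_iff_mem _).mpr hmem
  have heq := (isMaximal_span_θint_sub hc).eq_of_le v.isPrime.ne_top hle
  rw [← heq]
  rcases hc with rfl | rfl | rfl
  · push_cast; rw [sub_neg_eq_add, five_eq_mul₁]; exact Ideal.mul_mem_right _ _ (subset_span rfl)
  · push_cast; rw [five_eq_mul₂]; exact Ideal.mul_mem_right _ _ (subset_span rfl)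
  · push_cast; rw [sub_neg_eq_add, five_eq_mul₃]; exact Ideal.mul_mem_right _ _ (subset_span rfl)

/-- `N(θ - c) = -5` for `c = -1, 2, -2`. [folklore] -/
theorem norm_θ_sub {c : ℤ} (hc : c = -1 ∨ c = 2 ∨ c = -2) : Algebra.norm ℚ (θ - c : K) = -5 := by
  have h := Algebra.coe_norm_int (θint - c : 𝓞 K)
  rw [coe_θint_sub, norm_θint_sub] at h
  rw [← h]
  rcases hc with rfl | rfl | rfl <;> norm_num

/-- A parity bit `k ∈ {0, 1}` with `n ≡ k (mod 2)`. [folklore] -/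
theorem exists_bit (n : ℤ) : ∃ k : Fin 2, (2 : ℤ) ∣ n - (k : ℕ) := by
  rcases Int.emod_two_eq_zero_or_one n with h | h
  · exact ⟨0, by simp only [Fin.val_zero, Nat.cast_zero, sub_zero]; omega⟩
  · exact ⟨1, by simp only [Fin.val_one, Nat.cast_one]; omega⟩

/-! ### The real places: `x + 2` is totally positive -/

/-- The sign vector of an element of `K` under the three real embeddings. [folklore] -/
def sgn3 (z : K) : SignType × SignType × SignType := (SignType.sign (e₁ z), SignType.sign (e₂ z), SignType.sign (e₃ z))

/-- `sgn3` is multiplicative. [folklore] -/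
theorem sgn3_mul (z w : K) : sgn3 (z * w) = sgn3 z * sgn3 w := by
  simp only [sgn3, map_mul, sign_mul, Prod.mk_mul_mk]

/-- `sgn3` of a power. [folklore] -/
theorem sgn3_pow (z : K) (n : ℕ) : sgn3 (z ^ n) = sgn3 z ^ n := by
  induction n with
  | zero => simp only [pow_zero, sgn3, map_one, sign_one]; rfl
  | succ n ih => rw [pow_succ, sgn3_mul, ih, pow_succ]

/-- On units, `sgn3` is the sign vector `sgn`. [folklore] -/
theorem sgn3_coe_unit (u : (𝓞 K)ˣ) : sgn3 (((u : 𝓞 K)) : K) = sgn u := rfl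

/-- A non-zero square is totally positive. [folklore] -/
theorem sgn3_sq {B : K} (hB : B ≠ 0) : sgn3 (B ^ 2) = 1 := by
  have h : ∀ e : K →+* ℝ, SignType.sign (e (B ^ 2)) = 1 := fun e => by
    rw [map_pow]
    exact sign_pos (lt_of_le_of_ne (sq_nonneg _) (Ne.symm (pow_ne_zero 2 ((map_ne_zero e).mpr hB))))
  simp only [sgn3, h]; rfl

/-- `sgn3(θ + 1) = (-, +, +)`, `sgn3(θ - 2) = (-, -, -)`, `sgn3(θ + 2) = (-, +, +)`
(`r₁ ∈ (-3,-2)`, `r₂ ∈ (0,1)`, `r₃ ∈ (1,2)`). [folklore] -/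
theorem sgn3_generators : sgn3 (θ + 1) = (-1, 1, 1) ∧ sgn3 (θ - 2) = (-1, -1, -1) ∧ sgn3 (θ + 2) = (-1, 1, 1) := by
  have h1 := r₁_spec.1; have h2 := r₂_spec.1; have h3 := r₃_spec.1
  simp only [Set.mem_Ioo] at h1 h2 h3
  refine ⟨?_, ?_, ?_⟩ <;> simp only [sgn3, map_add, map_sub, map_one, map_ofNat, e₁_θ, e₂_θ, e₃_θ]
  · rw [sign_neg (by linarith), sign_pos (by linarith), sign_pos (by linarith)]
  · rw [sign_neg (by linarith), sign_neg (by linarith), sign_neg (by linarith)]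
  · rw [sign_neg (by linarith), sign_pos (by linarith), sign_pos (by linarith)]

/-- **On the real curve `Y² = X(X+2)(X-3)` with `Y ≠ 0` one has `X + 2 > 0`** (the cubic is positive
exactly on `(-2, 0) ∪ (3, ∞)`). [folklore] -/
theorem real_x_add_two_pos {X Y : ℝ} (h : Y ^ 2 = X * (X + 2) * (X - 3)) (hY : Y ≠ 0) : 0 < X + 2 := by
  by_contra hle
  rw [not_lt] at hle
  have hX : X ≤ -2 := by linarith
  have h1 : 0 < X * (X - 3) := by nlinarith
  have h2 : X * (X + 2) * (X - 3) = (X + 2) * (X * (X - 3)) := by ring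
  have h3 : 0 < Y ^ 2 := lt_of_le_of_ne (sq_nonneg Y) (Ne.symm (pow_ne_zero 2 hY))
  nlinarith

/-- **`x + 2` is totally positive** for a `K`-point of `y² = x(x+2)(x-3)` with `y ≠ 0`. [folklore] -/
theorem sgn3_x_add_two {x y : K} (hE : y ^ 2 = x * (x + 2) * (x - 3)) (hy : y ≠ 0) : sgn3 (x + 2) = 1 := by
  have h : ∀ e : K →+* ℝ, SignType.sign (e (x + 2)) = 1 := fun e => by
    rw [map_add, map_ofNat]
    refine sign_pos (real_x_add_two_pos (Y := e y) ?_ ((map_ne_zero e).mpr hy))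
    have := congrArg e hE
    simpa [map_pow, map_mul, map_add, map_sub, map_ofNat] using this
  simp only [sgn3, h]; rfl

/-- **The real survivors.** If `u' · (θ+1)^{k₁}(θ-2)^{k₂}(θ+2)^{k₃}` is totally positive for
`u' = (-1)^{a'} θ^{a'} (θ-1)^{j'}`, then `j' = 0`, `k₂ = a'`, and `k₁ = k₃` iff `a' = 0`: the four
possibilities `(u', k) = (1, 000), (1, 101), (-θ, 110), (-θ, 011)` (by the sign table). [folklore] -/
theorem real_survivors (a' j' k₁ k₂ k₃ : Fin 2)
    (h : sgn (rep a' a' j') * (((-1, 1, 1) : SignType × SignType × SignType) ^ (k₁ : ℕ) *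
      ((-1, -1, -1) : SignType × SignType × SignType) ^ (k₂ : ℕ) *
        ((-1, 1, 1) : SignType × SignType × SignType) ^ (k₃ : ℕ)) = 1) :
    (a' = 0 ∧ j' = 0 ∧ k₂ = 0 ∧ k₁ = k₃) ∨ (a' = 1 ∧ j' = 0 ∧ k₂ = 1 ∧ k₁ ≠ k₃) := by
  rw [sgn_rep] at h
  revert h
  fin_cases a' <;> fin_cases j' <;> fin_cases k₁ <;> fin_cases k₂ <;> fin_cases k₃ <;> decide

/-! ### At the primes above `5`: a square plus `2` has even order -/

/-- **The residue map `ψ_c : 𝓞 K → 𝔽₅`, `θ ↦ c`**, with kernel `(θ - c)` (`c = -1, 2, -2`). [folklore] -/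
theorem exists_ψ₅ {c : ℤ} (hc : c = -1 ∨ c = 2 ∨ c = -2) :
    ∃ ψ : 𝓞 K →+* ZMod 5, ψ θint = (c : ZMod 5) ∧ RingHom.ker ψ = span {(θint - c : 𝓞 K)} := by
  have hr : (c : ZMod 5) ^ 3 + (c : ZMod 5) ^ 2 - 4 * (c : ZMod 5) + 1 = 0 := by
    rcases hc with rfl | rfl | rfl <;> decide
  obtain ⟨ψ, hψ⟩ := exists_ringHom_apply_θint (c : ZMod 5) hr
  exact ⟨ψ, hψ, ker_eq_span_of_apply_θint hc ψ hψ⟩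

/-- `2 ∉ (θ - c)`: `v₅(c)(2) = 1`. [folklore] -/
theorem valuation_v₅_two {c : ℤ} (hc : c = -1 ∨ c = 2 ∨ c = -2) : (v₅ hc).valuation K (2 : K) = 1 := by
  obtain ⟨ψ, -, hker⟩ := exists_ψ₅ hc
  have h := (valuation_natCast_eq_one_iff (v₅ hc) 2).mpr
  push_cast at h
  apply h
  change (2 : 𝓞 K) ∉ span {(θint - c : 𝓞 K)}
  rw [← hker, RingHom.mem_ker, map_ofNat]
  decide

/-- In `𝔽₅`, `a² + 2b² = 0` forces `b = 0` (`-2 = 3` is not a square mod `5`). [folklore] -/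
theorem zmod5_sq_add_two_mul_sq : ∀ a b : ZMod 5, b ≠ 0 → a ^ 2 + 2 * b ^ 2 ≠ 0 := by decide

/-- **`ord_𝔭(A² + 2)` is even at each prime `𝔭 = (θ - c)` above `5`** (`A ∈ K`, `A ≠ 0`): if
`ord(A) > 0` the order is `ord(2) = 0`, if `ord(A) < 0` it is `2 ord(A)`, and if `ord(A) = 0` then
`A² + 2 ∈ 𝔭` would give `a² + 2b² ≡ 0 (mod 𝔭)` for the residues of `A = a/b`, impossible in `𝔽₅`.
[folklore] -/
theorem two_dvd_log_valuation_sq_add_two {A : K} (hA : A ≠ 0) {c : ℤ} (hc : c = -1 ∨ c = 2 ∨ c = -2) :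
    (2 : ℤ) ∣ WithZero.log ((v₅ hc).valuation K (A ^ 2 + 2)) := by
  set v := (v₅ hc).valuation K with hv
  have h2 : v 2 = 1 := valuation_v₅_two hc
  have hvA : v A ≠ 0 := (Valuation.ne_zero_iff v).mpr hA
  rcases lt_trichotomy (v A) 1 with hlt | heq | hgt
  · -- `v(A²) < 1 = v 2`, so `v(A² + 2) = v 2 = 1`
    have hA2 : v (A ^ 2) < v 2 := by
      rw [map_pow, h2, pow_two]
      calc v A * v A < 1 * 1 := mul_lt_mul'' hlt hlt zero_le zero_le
        _ = 1 := one_mul 1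
    rw [v.map_add_eq_of_lt_right hA2, h2, WithZero.log_one]
    exact dvd_zero 2
  · -- `v A = 1`: `A² + 2 ∈ 𝔭` is impossible
    by_contra hodd
    have hle : v (A ^ 2 + 2) ≤ 1 := v.map_add_le (by rw [map_pow, heq, one_pow]) h2.le
    have hne0 : A ^ 2 + 2 ≠ 0 := by
      intro h0; rw [h0, map_zero, WithZero.log_zero] at hodd; exact hodd (dvd_zero 2)
    have hv0 : v (A ^ 2 + 2) ≠ 0 := (Valuation.ne_zero_iff v).mpr hne0
    have hlt : v (A ^ 2 + 2) < 1 := by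
      refine lt_of_le_of_ne hle fun h1 => hodd ?_
      rw [h1, WithZero.log_one]; exact dvd_zero 2
    -- `A = n / d` with `d ∉ 𝔭`
    obtain ⟨n, d, hnd⟩ := exists_primeCompl_mul_eq_of_integer (v₅ hc) A heq.le
    obtain ⟨ψ, -, hker⟩ := exists_ψ₅ hc
    have hd : ψ d ≠ 0 := by
      intro h0
      have : (d : 𝓞 K) ∈ RingHom.ker ψ := h0
      rw [hker] at this
      exact d.2 this
    -- `W = n² + 2 d² ∈ 𝔭`
    have hW : (A ^ 2 + 2) * (algebraMap (𝓞 K) K d) ^ 2 = algebraMap (𝓞 K) K (n ^ 2 + 2 * d ^ 2) := by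
      rw [map_add, map_mul, map_pow, map_pow, map_ofNat, ← hnd]; ring
    have hvd : v (algebraMap (𝓞 K) K d) = 1 := by
      rw [hv, valuation_of_algebraMap, intValuation_eq_one_iff]; exact d.2
    have hWlt : v (algebraMap (𝓞 K) K (n ^ 2 + 2 * d ^ 2)) < 1 := by
      rw [← hW, map_mul, map_pow, hvd, one_pow, mul_one]; exact hlt
    rw [hv, valuation_lt_one_iff_mem] at hWlt
    change (n ^ 2 + 2 * d ^ 2 : 𝓞 K) ∈ span {(θint - c : 𝓞 K)} at hWlt
    rw [← hker, RingHom.mem_ker, map_add, map_mul, map_pow, map_pow, map_ofNat] at hWlt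
    exact zmod5_sq_add_two_mul_sq _ _ hd hWlt
  · -- `v(A²) > 1 ≥ v 2`, so `v(A² + 2) = v(A²)`
    have hA2 : v 2 < v (A ^ 2) := by
      rw [map_pow, h2, pow_two]
      calc (1 : ℤᵐ⁰) = 1 * 1 := (one_mul 1).symm
        _ < v A * v A := mul_lt_mul'' hgt hgt zero_le zero_le
    rw [v.map_add_eq_of_lt_left hA2, map_pow, WithZero.log_pow]
    exact ⟨WithZero.log (v A), by ring⟩

/-! ### The `2`-adic obstruction: reduction to `𝓞/8` -/

section TwoAdic

open CubicAlg

variable (ψ : 𝓞 K →+* CubicAlg (ZMod 8))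

/-- An element of `𝓞 K` outside `(2)` has odd image in `𝓞/8`. [folklore] -/
theorem isOdd_of_not_mem {z : 𝓞 K} (hz : z ∉ span {(2 : 𝓞 K)}) : IsOdd (ψ z) :=
  isOdd_of_not_two_dvd ψ (by rwa [Ideal.mem_span_singleton] at hz)

/-- `8 = 0` and `16 = 0` in `𝓞/8`. [folklore] -/
theorem eight_eq_zero : (8 : CubicAlg (ZMod 8)) = 0 ∧ (16 : CubicAlg (ZMod 8)) = 0 := by
  constructor <;> decide

/-- **Core of case `ord₂(x) = 0`.** If `α u² + 2e² = β w²` and `α u² - 3e² = αβ c²` in `𝓞 K` with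
`u, w ∉ (2)`, `ψ(e)² = 1` and `(ψ α, ψ β)` one of the twelve candidates, contradiction
(`no_solution_n0`). [folklore] -/
theorem core_n0 {αO βO u w c e : 𝓞 K} (hcand : (ψ αO, ψ βO) ∈ candidates12)
    (hu : u ∉ span {(2 : 𝓞 K)}) (hw : w ∉ span {(2 : 𝓞 K)}) (he : ψ e * ψ e = 1)
    (h1 : αO * u ^ 2 + 2 * e ^ 2 = βO * w ^ 2) (h2 : αO * u ^ 2 - 3 * e ^ 2 = αO * βO * c ^ 2) : False := by
  have e1 := congrArg ψ h1
  have e2 := congrArg ψ h2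
  simp only [map_add, map_sub, map_mul, map_ofNat, pow_two, he, mul_one] at e1 e2
  exact no_solution_n0 _ hcand _ (sq_mem_usq8 _ (isOdd_of_not_mem ψ hu)) _ (sq_mem_usq8 _ (isOdd_of_not_mem ψ hw))
    (by rw [← e1]) _ (sq_mem_asq8 (ψ c)) (by rw [← e2])

/-- **Core of case `ord₂(x) = -2`**: `α u² + 8e² = β w²`, `α u² - 12e² = αβ c²` with `u, w, c ∉ (2)`,
`ψ(e)² = 1`: contradiction (`no_solution_n1`; `8 = 0`, `-12 = 4` in `𝓞/8`). [folklore] -/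
theorem core_n1 {αO βO u w c e : 𝓞 K} (hcand : (ψ αO, ψ βO) ∈ candidates12)
    (hu : u ∉ span {(2 : 𝓞 K)}) (hw : w ∉ span {(2 : 𝓞 K)}) (hc : c ∉ span {(2 : 𝓞 K)}) (he : ψ e * ψ e = 1)
    (h1 : αO * u ^ 2 + 8 * e ^ 2 = βO * w ^ 2) (h2 : αO * u ^ 2 - 12 * e ^ 2 = αO * βO * c ^ 2) : False := by
  have e1 := congrArg ψ h1
  have e2 := congrArg ψ h2
  simp only [map_add, map_sub, map_mul, map_ofNat, pow_two, he, mul_one] at e1 e2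
  have h8 : (8 : CubicAlg (ZMod 8)) = 0 := eight_eq_zero.1
  have h16 : (16 : CubicAlg (ZMod 8)) = 0 := eight_eq_zero.2
  refine no_solution_n1 _ hcand _ (sq_mem_usq8 _ (isOdd_of_not_mem ψ hu)) _ (sq_mem_usq8 _ (isOdd_of_not_mem ψ hw))
    (by rw [← e1, h8]; ring) _ (sq_mem_usq8 _ (isOdd_of_not_mem ψ hc)) ?_
  rw [← e2]
  linear_combination h16

/-- **Core of case `ord₂(x) ≤ -4`**: `α u² + 2·4^M e² = β w²`, `α u² - 3·4^M e² = αβ c²` (`M ≥ 2`) with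
`u, w, c ∉ (2)`: contradiction (`no_solution_n2`; `4^M = 0` in `𝓞/8`). [folklore] -/
theorem core_n2 {αO βO u w c e : 𝓞 K} (hcand : (ψ αO, ψ βO) ∈ candidates12)
    (hu : u ∉ span {(2 : 𝓞 K)}) (hw : w ∉ span {(2 : 𝓞 K)}) (hc : c ∉ span {(2 : 𝓞 K)}) {M : ℕ} (hM : 2 ≤ M)
    (h1 : αO * u ^ 2 + 2 * 4 ^ M * e ^ 2 = βO * w ^ 2) (h2 : αO * u ^ 2 - 3 * 4 ^ M * e ^ 2 = αO * βO * c ^ 2) :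
    False := by
  have e1 := congrArg ψ h1
  have e2 := congrArg ψ h2
  have h4M : (4 : CubicAlg (ZMod 8)) ^ M = 0 := by
    obtain ⟨m, rfl⟩ := Nat.exists_eq_add_of_le hM
    rw [pow_add, show (4 : CubicAlg (ZMod 8)) ^ 2 = 0 from by decide, zero_mul]
  simp only [map_add, map_sub, map_mul, map_pow, map_ofNat, pow_two, h4M, mul_zero, zero_mul, add_zero,
    sub_zero] at e1 e2
  exact no_solution_n2 _ hcand _ (sq_mem_usq8 _ (isOdd_of_not_mem ψ hu)) _ (sq_mem_usq8 _ (isOdd_of_not_mem ψ hw))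
    (by rw [← e1]) _ (sq_mem_usq8 _ (isOdd_of_not_mem ψ hc)) (by rw [← e2])

end TwoAdic

/-! ### Odd integers and `2`-adic units of `K` -/

/-- An odd rational integer is not in `(2) ⊂ 𝓞 K` (reduce a relation `d = 2e` modulo `2` via any
ring homomorphism `𝓞 K → CubicAlg (ℤ/8) → CubicAlg (ℤ/2)`). [folklore] -/
theorem intCast_not_mem_span_two (ψ : 𝓞 K →+* CubicAlg (ZMod 8)) {d : ℤ} (hd : Odd d) :
    ((d : ℤ) : 𝓞 K) ∉ span {(2 : 𝓞 K)} := by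
  intro hmem
  rw [Ideal.mem_span_singleton] at hmem
  obtain ⟨e, he⟩ := hmem
  obtain ⟨k, rfl⟩ := hd
  have h := congrArg (CubicAlg.red82.comp ψ) he
  simp only [RingHom.comp_apply, map_intCast, map_mul, map_ofNat] at h
  have h2 : (2 : CubicAlg (ZMod 2)) = 0 := by decide
  rw [h2, zero_mul] at h
  -- `((2k+1 : ℤ) : CubicAlg (ZMod 2)) = 1 ≠ 0`
  have h1 : ((2 * k + 1 : ℤ) : CubicAlg (ZMod 2)) = 1 := by
    push_cast
    rw [h2, zero_mul, zero_add]
  rw [h1] at h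
  exact absurd h (by decide)

/-- For an odd integer `d`, `ψ(d)² = 1` in `𝓞/8` (`(2k+1)² = 4k(k+1) + 1 ≡ 1 (mod 8)`). [folklore] -/
theorem ψ_intCast_sq_eq_one (ψ : 𝓞 K →+* CubicAlg (ZMod 8)) {d : ℤ} (hd : Odd d) :
    ψ (d : 𝓞 K) * ψ (d : 𝓞 K) = 1 := by
  obtain ⟨k, rfl⟩ := hd
  obtain ⟨m, hm⟩ := Int.even_mul_succ_self k
  rw [map_intCast]
  have h8 : (8 : CubicAlg (ZMod 8)) = 0 := by decide
  have e : ((2 * k + 1 : ℤ) : CubicAlg (ZMod 8)) * ((2 * k + 1 : ℤ) : CubicAlg (ZMod 8)) =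
      4 * ((k * (k + 1) : ℤ) : CubicAlg (ZMod 8)) + 1 := by push_cast; ring
  rw [e, hm]
  push_cast
  linear_combination (m : CubicAlg (ZMod 8)) * h8

/-- `σint` preserves non-membership in `(2)`. [folklore] -/
theorem σint_not_mem_span_two {t : 𝓞 K} (ht : t ∉ span {(2 : 𝓞 K)}) : σint t ∉ span {(2 : 𝓞 K)} := by
  have hv2 : v₂.asIdeal = span {((2 : ℕ) : 𝓞 K)} := by simp [v₂]
  have h1 : v₂.intValuation (σint t) = v₂.intValuation t := intValuation_ringEquiv_eq v₂ hv2 σint t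
  intro hmem
  apply ht
  have : v₂.intValuation (σint t) < 1 := (intValuation_lt_one_iff_mem _ _).mpr hmem
  rw [h1] at this
  exact (intValuation_lt_one_iff_mem _ _).mp this

/-- The norm of `s ∈ 𝓞 K` as an element of `𝓞 K`: `N(s) = s · σs · σ²s`. [folklore] -/
theorem intCast_norm_eq (s : 𝓞 K) : ((Algebra.norm ℤ s : ℤ) : 𝓞 K) = s * σint s * σint (σint s) := by
  apply RingOfIntegers.coe_injective
  have h := norm_eq_mul_σ_mul_σσ (s : K)
  rw [← Algebra.coe_norm_int s, eq_ratCast, Rat.cast_intCast] at h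
  calc (((Algebra.norm ℤ s : ℤ) : 𝓞 K) : K) = ((Algebra.norm ℤ s : ℤ) : K) := by rfl
    _ = (s : K) * σ (s : K) * σ (σ (s : K)) := h
    _ = ((s * σint s * σint (σint s) : 𝓞 K) : K) := by push_cast; rfl

/-- **`2`-adic units of `K` have odd integral denominators.** If `v₂(z) ≤ 1` then `z · d = w` for some
`w ∈ 𝓞 K` and some ODD `d ∈ ℤ`, and `w ∉ (2)` when `v₂(z) = 1`: write `z = n/s` with `s ∉ (2)`
(Mathlib's `exists_primeCompl_mul_eq_of_integer`) and take `d = N(s) = s·σs·σ²s`, which is odd because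
`(2)` is a `σ`-stable prime. [folklore] -/
theorem exists_odd_int_mul_eq {z : K} (hz : v₂.valuation K z ≤ 1) :
    ∃ (w : 𝓞 K) (d : ℤ), Odd d ∧ z * (d : K) = (w : K) ∧ (v₂.valuation K z = 1 → w ∉ span {(2 : 𝓞 K)}) := by
  obtain ⟨n, s, hns⟩ := exists_primeCompl_mul_eq_of_integer v₂ z hz
  have hs : (s : 𝓞 K) ∉ span {(2 : 𝓞 K)} := s.2
  haveI := span_two.1
  set d : ℤ := Algebra.norm ℤ (s : 𝓞 K) with hd
  have hdO : (d : 𝓞 K) = s * σint s * σint (σint s) := intCast_norm_eq s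
  have hdnot : (d : 𝓞 K) ∉ span {(2 : 𝓞 K)} := by
    rw [hdO]
    intro hmem
    rcases (span_two.1).mem_or_mem hmem with h12 | h3
    · rcases (span_two.1).mem_or_mem h12 with h1 | h2
      · exact hs h1
      · exact σint_not_mem_span_two hs h2
    · exact σint_not_mem_span_two (σint_not_mem_span_two hs) h3
  have hodd : Odd d := by
    rw [← Int.not_even_iff_odd]
    rintro ⟨k, hk⟩
    apply hdnot
    rw [Ideal.mem_span_singleton]
    exact ⟨k, by rw [hk]; push_cast; ring⟩
  refine ⟨n * σint s * σint (σint s), d, hodd, ?_, fun hz1 => ?_⟩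
  · have e : (d : K) = (((d : 𝓞 K)) : K) := by rfl
    rw [e, hdO]
    push_cast
    have hns' : z * ((s : 𝓞 K) : K) = (n : K) := hns
    linear_combination (((σint s : 𝓞 K)) : K) * (((σint (σint s) : 𝓞 K)) : K) * hns'
  · intro hmem
    rcases (span_two.1).mem_or_mem hmem with h12 | h3
    · rcases (span_two.1).mem_or_mem h12 with h1 | h2
      · -- `n ∈ (2)` contradicts `v z = 1`, `v s = 1`
        have hvs : v₂.valuation K ((s : 𝓞 K) : K) = 1 := by
          rw [show ((s : 𝓞 K) : K) = algebraMap (𝓞 K) K s from rfl, valuation_of_algebraMap, intValuation_eq_one_iff]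
          exact hs
        have hvn : v₂.valuation K ((n : 𝓞 K) : K) < 1 := by
          rw [show ((n : 𝓞 K) : K) = algebraMap (𝓞 K) K n from rfl, valuation_lt_one_iff_mem]
          exact h1
        have : v₂.valuation K (z * ((s : 𝓞 K) : K)) = 1 := by rw [map_mul, hz1, hvs, mul_one]
        rw [show z * ((s : 𝓞 K) : K) = ((n : 𝓞 K) : K) from hns] at this
        exact absurd this hvn.ne
      · exact σint_not_mem_span_two hs h2
    · exact σint_not_mem_span_two (σint_not_mem_span_two hs) h3

/-! ### Norms of the unit representatives -/

/-- The norms of the representatives: `N(±θ^i(θ-1)^j) = (-1)^{a+i}` (`N(-1) = -1`, `N(θ) = -1`,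
`N(θ - 1) = 1`). [folklore] -/
theorem norm_rep (a i j : Fin 2) :
    Algebra.norm ℚ (((rep a i j : (𝓞 K)ˣ) : 𝓞 K) : K) = (-1) ^ (a : ℕ) * (-1) ^ (i : ℕ) := by
  have hθ1 : Algebra.norm ℚ (θ - 1) = 1 := by
    have := norm_quadratic 0 1 (-1)
    push_cast at this
    rw [show (0 : K) * θ ^ 2 + 1 * θ + -1 = θ - 1 by ring] at this
    rw [this]; norm_num
  have hneg : Algebra.norm ℚ (-1 : K) = -1 := by
    rw [show (-1 : K) = algebraMap ℚ K (-1) by simp, Algebra.norm_algebraMap, finrank_K]; norm_num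
  have hcoe : (((rep a i j : (𝓞 K)ˣ) : 𝓞 K) : K) = (-1) ^ (a : ℕ) * θ ^ (i : ℕ) * (θ - 1) ^ (j : ℕ) := by
    simp only [rep, Units.val_mul, Units.val_pow_eq_pow_val, Units.val_neg, Units.val_one, coe_unitθ,
      coe_unitθ₁]
    push_cast
    rfl
  rw [hcoe, map_mul, map_mul, map_pow, map_pow, map_pow, hneg, norm_θ, hθ1, one_pow, mul_one]

/-! ### The curve `480a1 : y² = x(x + 2)(x - 3)` over `K`: even valuations -/

section Curve

variable {x y : K} (hE : y ^ 2 = x * (x + 2) * (x - 3)) (hy : y ≠ 0)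
include hE hy

/-- `x ≠ 0`, `x + 2 ≠ 0`, `x - 3 ≠ 0` for a point with `y ≠ 0`. [folklore] -/
theorem x_ne : x ≠ 0 ∧ x + 2 ≠ 0 ∧ x - 3 ≠ 0 := by
  have h : x * (x + 2) * (x - 3) ≠ 0 := by rw [← hE]; exact pow_ne_zero 2 hy
  exact ⟨fun h0 => h (by rw [h0]; ring), fun h0 => h (by rw [h0]; ring), fun h0 => h (by rw [h0]; ring)⟩

/-- **`ord_v(x)` is even for every finite place `v`**: off `2, 3` by the valuation parity lemma of
the `2`-descent (`Valuation.two_dvd_log_map_sub_of_sq_eq`, `e = (0, -2, 3)`), and at the inert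
primes `(2)`, `(3)` by the norm condition `N(x) = □`. [folklore] -/
theorem two_dvd_log_valuation_x (hN : IsSquare (Algebra.norm ℚ x)) (v : HeightOneSpectrum (𝓞 K)) :
    (2 : ℤ) ∣ WithZero.log (v.valuation K x) := by
  obtain ⟨hx0, -, -⟩ := x_ne hE hy
  by_cases h2 : (2 : 𝓞 K) ∈ v.asIdeal
  · rw [eq_v₂_of_mem h2]
    exact two_dvd_log_valuation_of_isSquare_norm v₂ (p := 2) (by simp [v₂]) hx0 hN
  by_cases h3 : (3 : 𝓞 K) ∈ v.asIdeal
  · rw [eq_v₃_of_mem h3]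
    exact two_dvd_log_valuation_of_isSquare_norm v₃ (p := 3) (by simp [v₃]) hx0 hN
  have hv2 : v.valuation K (2 : K) = 1 := by exact_mod_cast (valuation_natCast_eq_one_iff v 2).mpr (by exact_mod_cast h2)
  have hv3 : v.valuation K (3 : K) = 1 := by exact_mod_cast (valuation_natCast_eq_one_iff v 3).mpr (by exact_mod_cast h3)
  have key := (v.valuation K).two_dvd_log_map_sub_of_sq_eq (e₁ := 0) (e₂ := -2) (e₃ := 3) (x := x) (y := y)
    (by rw [map_zero]; exact zero_le_one) (by simp only [Valuation.map_neg, hv2, le_refl]) (by rw [hv3])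
    (by simp only [zero_sub, Valuation.map_neg, hv2]) (by simp only [zero_sub, Valuation.map_neg, hv3]) hx0
    (by rw [hE]; ring)
  rwa [sub_zero] at key

/-- **`ord_v(x + 2)` is even for every finite place `v` not above `5`**: off `2, 5` by the parity
lemma (`e = (-2, 0, 3)`), at `(2)` by `N(x + 2) = □`. [folklore] -/
theorem two_dvd_log_valuation_x_add_two (hN : IsSquare (Algebra.norm ℚ (x + 2))) (v : HeightOneSpectrum (𝓞 K))
    (h5 : (5 : 𝓞 K) ∉ v.asIdeal) : (2 : ℤ) ∣ WithZero.log (v.valuation K (x + 2)) := by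
  obtain ⟨hx0, hx2, -⟩ := x_ne hE hy
  by_cases h2 : (2 : 𝓞 K) ∈ v.asIdeal
  · rw [eq_v₂_of_mem h2]
    exact two_dvd_log_valuation_of_isSquare_norm v₂ (p := 2) (by simp [v₂]) hx2 hN
  have hv2 : v.valuation K (2 : K) = 1 := by exact_mod_cast (valuation_natCast_eq_one_iff v 2).mpr (by exact_mod_cast h2)
  have hv5 : v.valuation K (5 : K) = 1 := by exact_mod_cast (valuation_natCast_eq_one_iff v 5).mpr (by exact_mod_cast h5)
  have hv3 : v.valuation K (3 : K) ≤ 1 := by exact_mod_cast valuation_natCast_le_one v 3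
  have key := (v.valuation K).two_dvd_log_map_sub_of_sq_eq (e₁ := -2) (e₂ := 0) (e₃ := 3) (x := x) (y := y)
    (by simp only [Valuation.map_neg, hv2, le_refl]) (by rw [map_zero]; exact zero_le_one) hv3
    (by simp only [sub_zero, Valuation.map_neg, hv2])
    (by rw [show (-2 : K) - 3 = -5 by norm_num]; simp only [Valuation.map_neg, hv5])
    (by rw [Ne, ← sub_eq_zero, sub_neg_eq_add]; exact hx2) (by rw [hE]; ring)
  rwa [sub_neg_eq_add] at key

/-! ### `x = u A²` with `u ∈ {±θ^i(θ-1)^j}` -/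

/-- **`x = u A²` with `u = ±θ^i(θ-1)^j`, `N(u) = +1`** (all valuations of `x` are even, `h_K = 1`,
units modulo squares; `N(x) = □` forces `N(u) > 0`, i.e. `a = i`). [folklore] -/
theorem exists_rep_mul_sq_x (hN : IsSquare (Algebra.norm ℚ x)) :
    ∃ (a j : Fin 2) (A : K), A ≠ 0 ∧ x = (((rep a a j : (𝓞 K)ˣ) : 𝓞 K) : K) * A ^ 2 := by
  obtain ⟨hx0, -, -⟩ := x_ne hE hy
  obtain ⟨u, w, hw⟩ := exists_unit_mul_sq_of_even_valuation (R := 𝓞 K) (L := K) hx0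
    (two_dvd_log_valuation_x (hE := hE) (hy := hy) (hN := hN))
  obtain ⟨a, i, j, η, hu⟩ := exists_eq_rep_mul_sq u
  have hx : x = (((rep a i j : (𝓞 K)ˣ) : 𝓞 K) : K) * ((((η : (𝓞 K)ˣ) : 𝓞 K) : K) * w) ^ 2 := by
    rw [hw, hu]
    simp only [Units.val_mul, Units.val_pow_eq_pow_val]
    push_cast
    ring
  have hA : (((η : (𝓞 K)ˣ) : 𝓞 K) : K) * w ≠ 0 := by
    intro h0; rw [h0] at hx; apply hx0; rw [hx]; ring
  -- `a = i` from `N(x) = □`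
  have hai : a = i := by
    have hNx : Algebra.norm ℚ x = (-1) ^ (a : ℕ) * (-1) ^ (i : ℕ) *
        (Algebra.norm ℚ ((((η : (𝓞 K)ˣ) : 𝓞 K) : K) * w)) ^ 2 := by
      rw [hx, map_mul, map_pow, norm_rep]
    have hq : Algebra.norm ℚ ((((η : (𝓞 K)ˣ) : 𝓞 K) : K) * w) ≠ 0 := Algebra.norm_ne_zero_iff.mpr hA
    by_contra hai
    have hprod : ((-1 : ℚ) ^ (a : ℕ) * (-1) ^ (i : ℕ)) = -1 := by
      fin_cases a <;> fin_cases i <;> first | exact absurd rfl hai | norm_num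
    rw [hprod] at hNx
    have hlt : Algebra.norm ℚ x < 0 := by rw [hNx]; nlinarith [sq_pos_iff.mpr hq]
    linarith [hN.nonneg]
  subst hai
  exact ⟨a, j, _, hA, hx⟩

/-! ### `x + 2 = u' (θ+1)^k₁ (θ-2)^k₂ (θ+2)^k₃ B²` -/

/-- **`x + 2 = u' · (θ+1)^{k₁} (θ-2)^{k₂} (θ+2)^{k₃} · B²` with `u' = ±θ^{i'}(θ-1)^{j'}`, `N(u') = +1`
and `k₁ + k₂ + k₃` even**: after multiplying `x + 2` by the `(θ - c)^{k_c}` matching the parities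
of its orders at the three primes above `5` all valuations are even (`two_dvd_log_valuation_x_add_two`,
`log_valuation_v₅_self`, `valuation_v₅_other`, `valuation_θ_sub_eq_one`), so it is a unit times a
square; `N(x+2) = (-1)^{a'+i'}(-5)^{k₁+k₂+k₃} N(B)²` is a rational square only if the exponent of `5`
is even and the sign is `+`. [folklore] -/
theorem exists_rep_mul_prod_mul_sq_x_add_two (hN : IsSquare (Algebra.norm ℚ (x + 2))) :
    ∃ (a' j' k₁ k₂ k₃ : Fin 2) (B : K), B ≠ 0 ∧ (2 ∣ (k₁ : ℕ) + k₂ + k₃) ∧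
      x + 2 = (((rep a' a' j' : (𝓞 K)ˣ) : 𝓞 K) : K) *
        ((θ + 1) ^ (k₁ : ℕ) * (θ - 2) ^ (k₂ : ℕ) * (θ + 2) ^ (k₃ : ℕ)) * B ^ 2 := by
  obtain ⟨-, hx2, -⟩ := x_ne hE hy
  set z := x + 2 with hz
  have hc1 : (-1 : ℤ) = -1 ∨ (-1 : ℤ) = 2 ∨ (-1 : ℤ) = -2 := Or.inl rfl
  have hc2 : (2 : ℤ) = -1 ∨ (2 : ℤ) = 2 ∨ (2 : ℤ) = -2 := Or.inr (Or.inl rfl)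
  have hc3 : (-2 : ℤ) = -1 ∨ (-2 : ℤ) = 2 ∨ (-2 : ℤ) = -2 := Or.inr (Or.inr rfl)
  obtain ⟨k₁, hk₁⟩ := exists_bit (WithZero.log ((v₅ hc1).valuation K z))
  obtain ⟨k₂, hk₂⟩ := exists_bit (WithZero.log ((v₅ hc2).valuation K z))
  obtain ⟨k₃, hk₃⟩ := exists_bit (WithZero.log ((v₅ hc3).valuation K z))
  -- the three generators as elements of `K`
  have hπ1 : (θ + 1 : K) = θ - ((-1 : ℤ) : K) := by push_cast; ring
  have hπ2 : (θ - 2 : K) = θ - ((2 : ℤ) : K) := by push_cast; ring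
  have hπ3 : (θ + 2 : K) = θ - ((-2 : ℤ) : K) := by push_cast; ring
  have hπ1ne : (θ + 1 : K) ≠ 0 := by rw [hπ1, ← coe_θint_sub]; exact RingOfIntegers.coe_ne_zero_iff.mpr (θint_sub_ne_zero hc1)
  have hπ2ne : (θ - 2 : K) ≠ 0 := by rw [hπ2, ← coe_θint_sub]; exact RingOfIntegers.coe_ne_zero_iff.mpr (θint_sub_ne_zero hc2)
  have hπ3ne : (θ + 2 : K) ≠ 0 := by rw [hπ3, ← coe_θint_sub]; exact RingOfIntegers.coe_ne_zero_iff.mpr (θint_sub_ne_zero hc3)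
  set P : K := (θ + 1) ^ (k₁ : ℕ) * (θ - 2) ^ (k₂ : ℕ) * (θ + 2) ^ (k₃ : ℕ) with hP
  have hP0 : P ≠ 0 := mul_ne_zero (mul_ne_zero (pow_ne_zero _ hπ1ne) (pow_ne_zero _ hπ2ne)) (pow_ne_zero _ hπ3ne)
  set z' := z * P with hz'
  have hz'0 : z' ≠ 0 := mul_ne_zero hx2 hP0
  -- all valuations of `z'` are even
  have heven : ∀ v : HeightOneSpectrum (𝓞 K), (2 : ℤ) ∣ WithZero.log (v.valuation K z') := by
    intro v
    have hvz : v.valuation K z ≠ 0 := (Valuation.ne_zero_iff _).mpr hx2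
    have hv1 : v.valuation K (θ + 1) ≠ 0 := (Valuation.ne_zero_iff _).mpr hπ1ne
    have hv2 : v.valuation K (θ - 2) ≠ 0 := (Valuation.ne_zero_iff _).mpr hπ2ne
    have hv3 : v.valuation K (θ + 2) ≠ 0 := (Valuation.ne_zero_iff _).mpr hπ3ne
    have hlog : WithZero.log (v.valuation K z') = WithZero.log (v.valuation K z) +
        ((k₁ : ℕ) • WithZero.log (v.valuation K (θ + 1)) + (k₂ : ℕ) • WithZero.log (v.valuation K (θ - 2)) +
          (k₃ : ℕ) • WithZero.log (v.valuation K (θ + 2))) := by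
      rw [hz', hP, map_mul, map_mul, map_mul, map_pow, map_pow, map_pow,
        WithZero.log_mul hvz (mul_ne_zero (mul_ne_zero (pow_ne_zero _ hv1) (pow_ne_zero _ hv2)) (pow_ne_zero _ hv3)),
        WithZero.log_mul (mul_ne_zero (pow_ne_zero _ hv1) (pow_ne_zero _ hv2)) (pow_ne_zero _ hv3),
        WithZero.log_mul (pow_ne_zero _ hv1) (pow_ne_zero _ hv2), WithZero.log_pow, WithZero.log_pow,
        WithZero.log_pow]
    rw [hlog]
    by_cases h5 : (5 : 𝓞 K) ∈ v.asIdeal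
    · rcases eq_v₅_of_mem h5 with hv | hv | hv <;> rw [hv] <;> rw [hv] at hvz
      · rw [hπ1, hπ2, hπ3, log_valuation_v₅_self hc1, valuation_v₅_other hc1 hc2 (by norm_num),
          valuation_v₅_other hc1 hc3 (by norm_num), WithZero.log_one, smul_zero, smul_zero, add_zero, add_zero,
          smul_neg, nsmul_eq_mul, mul_one, ← sub_eq_add_neg]
        exact hk₁
      · rw [hπ1, hπ2, hπ3, log_valuation_v₅_self hc2, valuation_v₅_other hc2 hc1 (by norm_num),
          valuation_v₅_other hc2 hc3 (by norm_num), WithZero.log_one, smul_zero, smul_zero, zero_add, add_zero,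
          smul_neg, nsmul_eq_mul, mul_one, ← sub_eq_add_neg]
        exact hk₂
      · rw [hπ1, hπ2, hπ3, log_valuation_v₅_self hc3, valuation_v₅_other hc3 hc1 (by norm_num),
          valuation_v₅_other hc3 hc2 (by norm_num), WithZero.log_one, smul_zero, smul_zero, zero_add, zero_add,
          smul_neg, nsmul_eq_mul, mul_one, ← sub_eq_add_neg]
        exact hk₃
    · rw [hπ1, hπ2, hπ3, valuation_θ_sub_eq_one h5 hc1, valuation_θ_sub_eq_one h5 hc2, valuation_θ_sub_eq_one h5 hc3,
        WithZero.log_one, smul_zero, smul_zero, smul_zero, add_zero, add_zero, add_zero]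
      exact two_dvd_log_valuation_x_add_two (hE := hE) (hy := hy) hN v h5
  -- `z' = u w²`, `u = u' η²`
  obtain ⟨u, w, hw⟩ := exists_unit_mul_sq_of_even_valuation (R := 𝓞 K) (L := K) hz'0 heven
  obtain ⟨a', i', j', η, hu⟩ := exists_eq_rep_mul_sq u
  have hw0 : w ≠ 0 := by rintro rfl; apply hz'0; rw [hw]; ring
  set B : K := (((η : (𝓞 K)ˣ) : 𝓞 K) : K) * w / P with hB
  have hη0 : ((((η : (𝓞 K)ˣ) : 𝓞 K) : K)) ≠ 0 := RingOfIntegers.coe_ne_zero_iff.mpr (Units.ne_zero η)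
  have hB0 : B ≠ 0 := div_ne_zero (mul_ne_zero hη0 hw0) hP0
  have hzB : z = (((rep a' i' j' : (𝓞 K)ˣ) : 𝓞 K) : K) * P * B ^ 2 := by
    have e : z * P = (((rep a' i' j' : (𝓞 K)ˣ) : 𝓞 K) : K) * ((((η : (𝓞 K)ˣ) : 𝓞 K) : K) * w) ^ 2 := by
      rw [← hz', hw, hu]
      simp only [Units.val_mul, Units.val_pow_eq_pow_val]
      push_cast
      ring
    have hP2 : P ^ 2 ≠ 0 := pow_ne_zero 2 hP0
    rw [hB, div_pow, show (((rep a' i' j' : (𝓞 K)ˣ) : 𝓞 K) : K) * P *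
        (((((η : (𝓞 K)ˣ) : 𝓞 K) : K) * w) ^ 2 / P ^ 2) =
        (((rep a' i' j' : (𝓞 K)ˣ) : 𝓞 K) : K) * ((((η : (𝓞 K)ˣ) : 𝓞 K) : K) * w) ^ 2 * P / P ^ 2 by ring,
      ← e, mul_assoc, ← pow_two, mul_div_assoc, div_self hP2, mul_one]
  -- the norm: `N(z) = (-1)^{a'+i'} (-5)^{k₁+k₂+k₃} N(B)²`
  have hNP : Algebra.norm ℚ P = (-5) ^ ((k₁ : ℕ) + k₂ + k₃) := by
    rw [hP, map_mul, map_mul, map_pow, map_pow, map_pow, hπ1, hπ2, hπ3, norm_θ_sub hc1, norm_θ_sub hc2,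
      norm_θ_sub hc3, ← pow_add, ← pow_add]
  have hNz : Algebra.norm ℚ z = (-1) ^ (a' : ℕ) * (-1) ^ (i' : ℕ) * (-5) ^ ((k₁ : ℕ) + k₂ + k₃) *
      (Algebra.norm ℚ B) ^ 2 := by
    rw [hzB, map_mul, map_mul, map_pow, norm_rep, hNP]
  have hNB : Algebra.norm ℚ B ≠ 0 := Algebra.norm_ne_zero_iff.mpr hB0
  -- (i) `k₁ + k₂ + k₃` is even (`5`-adic valuation of a square)
  have hkeven : 2 ∣ (k₁ : ℕ) + k₂ + k₃ := by
    haveI : Fact (Nat.Prime 5) := ⟨Nat.prime_five⟩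
    obtain ⟨r, hr⟩ := hN
    have hr0 : r ≠ 0 := by
      rintro rfl; rw [mul_zero] at hr; exact Algebra.norm_ne_zero_iff.mpr hx2 hr
    have hval := congrArg (padicValRat 5) hr
    have h1 : padicValRat 5 ((-1 : ℚ) ^ (a' : ℕ)) = 0 := by
      rw [padicValRat.pow (-1 : ℚ), padicValRat.neg, padicValRat.one, mul_zero]
    have h2 : padicValRat 5 ((-1 : ℚ) ^ (i' : ℕ)) = 0 := by
      rw [padicValRat.pow (-1 : ℚ), padicValRat.neg, padicValRat.one, mul_zero]
    have h3 : padicValRat 5 ((-5 : ℚ) ^ ((k₁ : ℕ) + k₂ + k₃)) = (((k₁ : ℕ) + k₂ + k₃ : ℕ) : ℤ) := by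
      rw [padicValRat.pow (-5 : ℚ), padicValRat.neg,
        show (5 : ℚ) = ((5 : ℕ) : ℚ) by norm_num, padicValRat.self (by norm_num), mul_one]
    have h4 : padicValRat 5 ((Algebra.norm ℚ B) ^ 2) = 2 * padicValRat 5 (Algebra.norm ℚ B) := by
      rw [padicValRat.pow (Algebra.norm ℚ B)]; push_cast; ring
    have h5 : padicValRat 5 (r * r) = 2 * padicValRat 5 r := by rw [padicValRat.mul hr0 hr0]; ring
    rw [hNz, padicValRat.mul (mul_ne_zero (mul_ne_zero (pow_ne_zero _ (by norm_num)) (pow_ne_zero _ (by norm_num)))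
        (pow_ne_zero _ (by norm_num))) (pow_ne_zero _ hNB),
      padicValRat.mul (mul_ne_zero (pow_ne_zero _ (by norm_num)) (pow_ne_zero _ (by norm_num))) (pow_ne_zero _ (by norm_num)),
      padicValRat.mul (pow_ne_zero _ (by norm_num)) (pow_ne_zero _ (by norm_num)), h1, h2, h3, h4, h5] at hval
    have h2 : (2 : ℤ) ∣ (((k₁ : ℕ) + k₂ + k₃ : ℕ) : ℤ) :=
      ⟨padicValRat 5 r - padicValRat 5 (Algebra.norm ℚ B), by linarith⟩
    exact_mod_cast h2
  -- (ii) the sign: `a' = i'`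
  have hai : a' = i' := by
    by_contra hai
    have hprod : ((-1 : ℚ) ^ (a' : ℕ) * (-1) ^ (i' : ℕ)) = -1 := by
      fin_cases a' <;> fin_cases i' <;> first | exact absurd rfl hai | norm_num
    obtain ⟨m, hm⟩ := hkeven
    rw [hprod, hm, pow_mul, show ((-5 : ℚ)) ^ 2 = 25 by norm_num] at hNz
    have hlt : Algebra.norm ℚ z < 0 := by
      rw [hNz]
      have h25 : (0 : ℚ) < 25 ^ m := by positivity
      nlinarith [sq_pos_iff.mpr hNB, mul_pos h25 (sq_pos_iff.mpr hNB)]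
    linarith [hN.nonneg]
  subst hai
  exact ⟨a', j', k₁, k₂, k₃, B, hB0, hkeven, hzB⟩

end Curve

/-! ### The `2`-adic obstruction for the twelve candidate classes -/

section Obstruction

open CubicAlg

/-- `v₂(2) = exp(-1)` (`(2)` is prime, so `2` is a uniformizer). [folklore] -/
theorem valuation_v₂_two : v₂.valuation K (2 : K) = WithZero.exp (-1) := by
  rw [← map_ofNat (algebraMap (𝓞 K) K) 2, valuation_of_algebraMap, v₂.intValuation_singleton (by norm_num) rfl]

/-- A product of three elements outside the prime `(2)` is outside `(2)`. [folklore] -/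
theorem mul_mul_not_mem_span_two {a b c : 𝓞 K} (ha : a ∉ span {(2 : 𝓞 K)}) (hb : b ∉ span {(2 : 𝓞 K)})
    (hc : c ∉ span {(2 : 𝓞 K)}) : a * b * c ∉ span {(2 : 𝓞 K)} := fun h => by
  rcases (span_two.1).mem_or_mem h with hab | h3
  · rcases (span_two.1).mem_or_mem hab with h1 | h2
    · exact ha h1
    · exact hb h2
  · exact hc h3

/-- In `ℤᵐ⁰`, `log a ≤ 0 ↔ a ≤ 1` for `a ≠ 0`. [folklore] -/
theorem log_nonpos_iff {a : ℤᵐ⁰} (ha : a ≠ 0) : WithZero.log a ≤ 0 ↔ a ≤ 1 := by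
  rw [← WithZero.log_one]; exact WithZero.log_le_log ha one_ne_zero

/-- For odd integers `dA, dB, dC`, `ψ(dA dB dC)² = 1` in `𝓞/8`. [folklore] -/
theorem ψ_prod_sq_eq_one (ψ : 𝓞 K →+* CubicAlg (ZMod 8)) {dA dB dC : ℤ} (hA : Odd dA) (hB : Odd dB)
    (hC : Odd dC) : ψ ((dA : 𝓞 K) * dB * dC) * ψ ((dA : 𝓞 K) * dB * dC) = 1 := by
  have h := ψ_intCast_sq_eq_one ψ ((hA.mul hB).mul hC)
  push_cast at h
  exact h

/-- **The `2`-adic obstruction.** Let `α, β ∈ 𝓞 K ∖ (2)` with `(ψ₈ α, ψ₈ β)` one of the twelve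
candidate pairs, and suppose `x = α A²`, `x + 2 = β B²` (`A, B ∈ Kˣ`) for a point `(x, y)`, `y ≠ 0`, of
`y² = x(x+2)(x-3)`. This is impossible: with `x - 3 = αβ C²`, `C = y/(αβAB)`, according to
`ord₂(A) > 0`, `= 0`, `= -M < 0` one gets `ord₂(x + 2) = 1` odd, resp. the congruences of
`core_n0`, resp. (`M = 1`) `core_n1` / (`M ≥ 2`) `core_n2` modulo `8`, after clearing odd integral
denominators (`exists_odd_int_mul_eq`). [folklore] -/
theorem two_adic_obstruction (ψ : 𝓞 K →+* CubicAlg (ZMod 8)) {αO βO : 𝓞 K}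
    (hα : αO ∉ span {(2 : 𝓞 K)}) (hβ : βO ∉ span {(2 : 𝓞 K)}) (hcand : (ψ αO, ψ βO) ∈ candidates12)
    {x y A B : K} (hE : y ^ 2 = x * (x + 2) * (x - 3)) (hy : y ≠ 0) (hA : A ≠ 0) (hB : B ≠ 0)
    (hxA : x = (αO : K) * A ^ 2) (hxB : x + 2 = (βO : K) * B ^ 2) : False := by
  set v := v₂.valuation K with hv
  have hv2 : v 2 = WithZero.exp (-1) := valuation_v₂_two
  have hv3 : v (3 : K) ≤ 1 := by exact_mod_cast valuation_natCast_le_one v₂ 3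
  have hvα : v (αO : K) = 1 := by
    rw [hv, RingOfIntegers.coe_eq_algebraMap, valuation_of_algebraMap, intValuation_eq_one_iff]; exact hα
  have hvβ : v (βO : K) = 1 := by
    rw [hv, RingOfIntegers.coe_eq_algebraMap, valuation_of_algebraMap, intValuation_eq_one_iff]; exact hβ
  have hα0 : ((αO : 𝓞 K) : K) ≠ 0 := fun h0 => by rw [h0, map_zero] at hvα; exact zero_ne_one hvα
  have hβ0 : ((βO : 𝓞 K) : K) ≠ 0 := fun h0 => by rw [h0, map_zero] at hvβ; exact zero_ne_one hvβ
  obtain ⟨hx0, hx2, hx3⟩ := x_ne hE hy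
  -- the third coordinate `x - 3 = αβ C²`
  set C : K := y / (((αO : 𝓞 K) : K) * ((βO : 𝓞 K) : K) * A * B) with hC
  have hden : ((αO : 𝓞 K) : K) * ((βO : 𝓞 K) : K) * A * B ≠ 0 :=
    mul_ne_zero (mul_ne_zero (mul_ne_zero hα0 hβ0) hA) hB
  have hC0 : C ≠ 0 := div_ne_zero hy hden
  have key : y ^ 2 = (((αO : 𝓞 K) : K) * A ^ 2) * (((βO : 𝓞 K) : K) * B ^ 2) * (x - 3) := by
    rw [← hxA, ← hxB]; exact hE
  have hxC : x - 3 = ((αO : 𝓞 K) : K) * ((βO : 𝓞 K) : K) * C ^ 2 := by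
    have hprod : ((αO : 𝓞 K) : K) * A ^ 2 * (((βO : 𝓞 K) : K) * B ^ 2) ≠ 0 :=
      mul_ne_zero (mul_ne_zero hα0 (pow_ne_zero 2 hA)) (mul_ne_zero hβ0 (pow_ne_zero 2 hB))
    have hx3' : x - 3 = y ^ 2 / ((((αO : 𝓞 K) : K) * A ^ 2) * (((βO : 𝓞 K) : K) * B ^ 2)) := by
      rw [key, mul_div_cancel_left₀ _ hprod]
    rw [hx3', hC, div_pow]
    field_simp
  have hvA0 : v A ≠ 0 := (Valuation.ne_zero_iff v).mpr hA
  have hvB0 : v B ≠ 0 := (Valuation.ne_zero_iff v).mpr hB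
  have hvC0 : v C ≠ 0 := (Valuation.ne_zero_iff v).mpr hC0
  -- logs of the three coordinates
  have hlx2 : WithZero.log (v (x + 2)) = 2 * WithZero.log (v B) := by
    rw [hxB, map_mul, map_pow, hvβ, one_mul, WithZero.log_pow, nsmul_eq_mul]; push_cast; ring
  have hlx3 : WithZero.log (v (x - 3)) = 2 * WithZero.log (v C) := by
    rw [hxC, map_mul, map_mul, map_pow, hvα, hvβ, one_mul, one_mul, WithZero.log_pow, nsmul_eq_mul]
    push_cast; ring
  have hlx : WithZero.log (v x) = 2 * WithZero.log (v A) := by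
    rw [hxA, map_mul, map_pow, hvα, one_mul, WithZero.log_pow, nsmul_eq_mul]; push_cast; ring
  have hvx0 : v x ≠ 0 := (Valuation.ne_zero_iff v).mpr hx0
  have hvx30 : v (x - 3) ≠ 0 := (Valuation.ne_zero_iff v).mpr hx3
  have hxB' : ((αO : 𝓞 K) : K) * A ^ 2 + 2 = ((βO : 𝓞 K) : K) * B ^ 2 := by rw [← hxA]; exact hxB
  have hxC' : ((αO : 𝓞 K) : K) * A ^ 2 - 3 = ((αO : 𝓞 K) : K) * ((βO : 𝓞 K) : K) * C ^ 2 := by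
    rw [← hxA]; exact hxC
  rcases lt_trichotomy (WithZero.log (v A)) 0 with hlt | heq | hgt
  · -- `ord₂ A ≥ 1`: `v x ≤ exp(-2) < v 2`, so `v(x + 2) = v 2` has odd log
    have hvx : v x < v 2 := by
      rw [← WithZero.exp_log hvx0, hlx, hv2, WithZero.exp_lt_exp]; omega
    have h := congrArg WithZero.log (v.map_add_eq_of_lt_right hvx)
    rw [hlx2, hv2, WithZero.log_exp] at h
    omega
  · -- `ord₂ A = 0`
    have hvA : v A = 1 := by rw [← WithZero.exp_log hvA0, heq, WithZero.exp_zero]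
    have hvx : v x = 1 := by rw [← WithZero.exp_log hvx0, hlx, heq, mul_zero, WithZero.exp_zero]
    have hvx2 : v (x + 2) = 1 := by
      rw [v.map_add_eq_of_lt_left (by rw [hvx, hv2, ← WithZero.exp_zero, WithZero.exp_lt_exp]; norm_num)]
      exact hvx
    have hvB : v B = 1 := by
      have h := congrArg WithZero.log hvx2
      rw [hlx2, WithZero.log_one] at h
      rw [← WithZero.exp_log hvB0, show WithZero.log (v B) = 0 by omega, WithZero.exp_zero]
    have hvx3 : v (x - 3) ≤ 1 := v.map_sub_le hvx.le hv3
    have hvC : v C ≤ 1 := by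
      have h := (log_nonpos_iff hvx30).mpr hvx3
      rw [hlx3] at h
      exact (log_nonpos_iff hvC0).mp (by omega)
    obtain ⟨A₁, dA, hdA, hAd, hA₁⟩ := exists_odd_int_mul_eq hvA.le
    obtain ⟨B₁, dB, hdB, hBd, hB₁⟩ := exists_odd_int_mul_eq hvB.le
    obtain ⟨C₁, dC, hdC, hCd, -⟩ := exists_odd_int_mul_eq hvC
    have hA₁' := hA₁ hvA
    have hB₁' := hB₁ hvB
    have hAd' : A * (dA : K) = algebraMap (𝓞 K) K A₁ := hAd
    have hBd' : B * (dB : K) = algebraMap (𝓞 K) K B₁ := hBd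
    have hCd' : C * (dC : K) = algebraMap (𝓞 K) K C₁ := hCd
    have hxB'' : algebraMap (𝓞 K) K αO * A ^ 2 + 2 = algebraMap (𝓞 K) K βO * B ^ 2 := hxB'
    have hxC'' : algebraMap (𝓞 K) K αO * A ^ 2 - 3 = algebraMap (𝓞 K) K αO * algebraMap (𝓞 K) K βO * C ^ 2 := hxC'
    have h1O : αO * (A₁ * dB * dC) ^ 2 + 2 * ((dA : 𝓞 K) * dB * dC) ^ 2 = βO * (B₁ * dA * dC) ^ 2 := by
      apply RingOfIntegers.coe_injective
      simp only [map_add, map_mul, map_pow, map_ofNat, map_intCast]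
      rw [← hAd', ← hBd']
      linear_combination ((dA : K) * dB * dC) ^ 2 * hxB''
    have h2O : αO * (A₁ * dB * dC) ^ 2 - 3 * ((dA : 𝓞 K) * dB * dC) ^ 2 = αO * βO * (C₁ * dA * dB) ^ 2 := by
      apply RingOfIntegers.coe_injective
      simp only [map_sub, map_mul, map_pow, map_ofNat, map_intCast]
      rw [← hAd', ← hCd']
      linear_combination ((dA : K) * dB * dC) ^ 2 * hxC''
    exact core_n0 ψ hcand
      (mul_mul_not_mem_span_two hA₁' (intCast_not_mem_span_two ψ hdB) (intCast_not_mem_span_two ψ hdC))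
      (mul_mul_not_mem_span_two hB₁' (intCast_not_mem_span_two ψ hdA) (intCast_not_mem_span_two ψ hdC))
      (ψ_prod_sq_eq_one ψ hdA hdB hdC) h1O h2O
  · -- `ord₂ A = -M < 0`, `M ≥ 1`: rescale by `2^M`
    obtain ⟨M, hM⟩ : ∃ M : ℕ, WithZero.log (v A) = M :=
      ⟨(WithZero.log (v A)).toNat, (Int.toNat_of_nonneg hgt.le).symm⟩
    have hM1 : 1 ≤ M := by omega
    have hvx : v x = WithZero.exp (2 * (M : ℤ)) := by rw [← WithZero.exp_log hvx0, hlx, hM]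
    have hvx2 : v (x + 2) = v x :=
      v.map_add_eq_of_lt_left (by rw [hvx, hv2, WithZero.exp_lt_exp]; omega)
    have hvx3 : v (x - 3) = v x := by
      rw [sub_eq_add_neg]
      refine v.map_add_eq_of_lt_left ?_
      rw [Valuation.map_neg, hvx]
      calc v 3 ≤ 1 := hv3
        _ = WithZero.exp 0 := WithZero.exp_zero.symm
        _ < WithZero.exp (2 * (M : ℤ)) := WithZero.exp_lt_exp.mpr (by omega)
    have hlB : WithZero.log (v B) = M := by
      have h := congrArg WithZero.log hvx2; rw [hlx2, hvx, WithZero.log_exp] at h; omega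
    have hlC : WithZero.log (v C) = M := by
      have h := congrArg WithZero.log hvx3; rw [hlx3, hvx, WithZero.log_exp] at h; omega
    -- the rescaled units `A₀ = 2^M A`, `B₀ = 2^M B`, `C₀ = 2^M C`
    have hunit : ∀ Z : K, WithZero.log (v Z) = M → v Z ≠ 0 → v (Z * 2 ^ M) = 1 := by
      intro Z hZ hZ0
      have hne : v (Z * 2 ^ M) ≠ 0 := by
        rw [map_mul, map_pow, hv2]; exact mul_ne_zero hZ0 (pow_ne_zero _ (by simp))
      rw [← WithZero.exp_log hne, ← WithZero.exp_zero]
      congr 1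
      rw [map_mul, map_pow, WithZero.log_mul hZ0 (pow_ne_zero _ (by rw [hv2]; simp)), WithZero.log_pow, hv2,
        WithZero.log_exp, hZ, nsmul_eq_mul]
      ring
    have hvA₀ := hunit A hM hvA0
    have hvB₀ := hunit B hlB hvB0
    have hvC₀ := hunit C hlC hvC0
    obtain ⟨A₁, dA, hdA, hAd, hA₁⟩ := exists_odd_int_mul_eq hvA₀.le
    obtain ⟨B₁, dB, hdB, hBd, hB₁⟩ := exists_odd_int_mul_eq hvB₀.le
    obtain ⟨C₁, dC, hdC, hCd, hC₁⟩ := exists_odd_int_mul_eq hvC₀.le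
    have hA₁' := hA₁ hvA₀
    have hB₁' := hB₁ hvB₀
    have hC₁' := hC₁ hvC₀
    have e4 : (4 : K) ^ M = (2 ^ M) ^ 2 := by
      rw [← pow_mul, mul_comm, pow_mul]; norm_num
    have hAd' : A * 2 ^ M * (dA : K) = algebraMap (𝓞 K) K A₁ := hAd
    have hBd' : B * 2 ^ M * (dB : K) = algebraMap (𝓞 K) K B₁ := hBd
    have hCd' : C * 2 ^ M * (dC : K) = algebraMap (𝓞 K) K C₁ := hCd
    have hxB'' : algebraMap (𝓞 K) K αO * A ^ 2 + 2 = algebraMap (𝓞 K) K βO * B ^ 2 := hxB'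
    have hxC'' : algebraMap (𝓞 K) K αO * A ^ 2 - 3 = algebraMap (𝓞 K) K αO * algebraMap (𝓞 K) K βO * C ^ 2 := hxC'
    have h1O : αO * (A₁ * dB * dC) ^ 2 + 2 * 4 ^ M * ((dA : 𝓞 K) * dB * dC) ^ 2 = βO * (B₁ * dA * dC) ^ 2 := by
      apply RingOfIntegers.coe_injective
      simp only [map_add, map_mul, map_pow, map_ofNat, map_intCast]
      rw [← hAd', ← hBd', e4]
      linear_combination ((dA : K) * dB * dC * 2 ^ M) ^ 2 * hxB''
    have h2O : αO * (A₁ * dB * dC) ^ 2 - 3 * 4 ^ M * ((dA : 𝓞 K) * dB * dC) ^ 2 =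
        αO * βO * (C₁ * dA * dB) ^ 2 := by
      apply RingOfIntegers.coe_injective
      simp only [map_sub, map_mul, map_pow, map_ofNat, map_intCast]
      rw [← hAd', ← hCd', e4]
      linear_combination ((dA : K) * dB * dC * 2 ^ M) ^ 2 * hxC''
    have hu := mul_mul_not_mem_span_two hA₁' (intCast_not_mem_span_two ψ hdB) (intCast_not_mem_span_two ψ hdC)
    have hw := mul_mul_not_mem_span_two hB₁' (intCast_not_mem_span_two ψ hdA) (intCast_not_mem_span_two ψ hdC)
    have hc := mul_mul_not_mem_span_two hC₁' (intCast_not_mem_span_two ψ hdA) (intCast_not_mem_span_two ψ hdB)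
    have he := ψ_prod_sq_eq_one ψ hdA hdB hdC
    rcases Nat.lt_or_ge M 2 with hM2 | hM2
    · obtain rfl : M = 1 := by omega
      rw [pow_one] at h1O h2O
      exact core_n1 ψ hcand hu hw hc he (by linear_combination h1O) (by linear_combination h2O)
    · exact core_n2 ψ hcand hu hw hc hM2 h1O h2O

end Obstruction


/-! ### Assembly: the norm-`1` descent statement for `K` -/

section Assembly

open CubicAlg

/-- A unit of `𝓞 K` is not in the prime `(2)`. [folklore] -/
theorem unit_not_mem_span_two (u : (𝓞 K)ˣ) : ((u : 𝓞 K)) ∉ span {(2 : 𝓞 K)} := fun h =>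
  (span_two.1).ne_top (Ideal.eq_top_of_isUnit_mem _ h u.isUnit)

/-- `θ - c ∉ (2)` for `c = -1, 2, -2` (`v₂(θ - c) = 1`, as `5 ∉ (2)`). [folklore] -/
theorem θint_sub_not_mem_span_two {c : ℤ} (hc : c = -1 ∨ c = 2 ∨ c = -2) : (θint - c : 𝓞 K) ∉ span {(2 : 𝓞 K)} := by
  have h5 : (5 : 𝓞 K) ∉ v₂.asIdeal := by
    intro h5
    apply (span_two.1).ne_top
    rw [Ideal.eq_top_iff_one]
    have h2 : (2 : 𝓞 K) ∈ v₂.asIdeal := subset_span rfl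
    have := Ideal.sub_mem _ h5 (Ideal.mul_mem_left _ 2 h2)
    rwa [show (5 : 𝓞 K) - 2 * 2 = 1 by norm_num] at this
  have h := valuation_θ_sub_eq_one h5 hc
  rw [← coe_θint_sub, RingOfIntegers.coe_eq_algebraMap, valuation_of_algebraMap, intValuation_eq_one_iff] at h
  exact h

/-- A product `u · (θ+1)^{k₁} (θ-2)^{k₂} (θ+2)^{k₃}` with `u` a unit is not in `(2)`. [folklore] -/
theorem rep_mul_prod_not_mem_span_two (u : (𝓞 K)ˣ) (k₁ k₂ k₃ : ℕ) :
    (u : 𝓞 K) * ((θint + 1) ^ k₁ * (θint - 2) ^ k₂ * (θint + 2) ^ k₃) ∉ span {(2 : 𝓞 K)} := by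
  haveI := span_two.1
  have h1 : (θint + 1 : 𝓞 K) ∉ span {(2 : 𝓞 K)} := by
    have := θint_sub_not_mem_span_two (Or.inl rfl); push_cast at this; rwa [sub_neg_eq_add] at this
  have h2 : (θint - 2 : 𝓞 K) ∉ span {(2 : 𝓞 K)} := by
    have := θint_sub_not_mem_span_two (Or.inr (Or.inl rfl)); push_cast at this; exact this
  have h3 : (θint + 2 : 𝓞 K) ∉ span {(2 : 𝓞 K)} := by
    have := θint_sub_not_mem_span_two (Or.inr (Or.inr rfl)); push_cast at this; rwa [sub_neg_eq_add] at this
  have hp : ∀ {z : 𝓞 K} (n : ℕ), z ∉ span {(2 : 𝓞 K)} → z ^ n ∉ span {(2 : 𝓞 K)} := fun n hz hmem =>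
    hz ((span_two.1).mem_of_pow_mem n hmem)
  intro hmem
  rcases (span_two.1).mem_or_mem hmem with hu | hP
  · exact unit_not_mem_span_two u hu
  · rcases (span_two.1).mem_or_mem hP with h12 | h3'
    · rcases (span_two.1).mem_or_mem h12 with h1' | h2'
      · exact hp k₁ h1 h1'
      · exact hp k₂ h2 h2'
    · exact hp k₃ h3 h3'

/-- The images under `ψ₈` (`θ ↦ t`) of the unit representatives and of the generators. [folklore] -/
theorem ψ_rep (ψ : 𝓞 K →+* CubicAlg (ZMod 8)) (hψ : ψ θint = t) (a i j : Fin 2) :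
    ψ ((rep a i j : (𝓞 K)ˣ) : 𝓞 K) = (-1) ^ (a : ℕ) * t ^ (i : ℕ) * (t - 1) ^ (j : ℕ) := by
  simp only [rep, Units.val_mul, Units.val_pow_eq_pow_val, Units.val_neg, Units.val_one, coe_unitθ, coe_unitθ₁,
    map_mul, map_pow, map_neg, map_one, map_sub, hψ]

/-- **The twelve candidates are exactly the pairs produced by a norm-`1` unit class `u ≠ 1` and a
real survivor.** [folklore] -/
theorem mem_candidates12 (a j a' k₁ k₂ k₃ : Fin 2) (haj : ¬ (a = 0 ∧ j = 0))
    (hk : (a' = 0 ∧ k₂ = 0 ∧ k₁ = k₃) ∨ (a' = 1 ∧ k₂ = 1 ∧ k₁ ≠ k₃)) :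
    (((-1 : CubicAlg (ZMod 8)) ^ (a : ℕ) * t ^ (a : ℕ) * (t - 1) ^ (j : ℕ),
      (-1 : CubicAlg (ZMod 8)) ^ (a' : ℕ) * t ^ (a' : ℕ) * (t - 1) ^ ((0 : Fin 2) : ℕ) *
        ((t + 1) ^ (k₁ : ℕ) * (t - 2) ^ (k₂ : ℕ) * (t + 2) ^ (k₃ : ℕ))) ∈ candidates12) := by
  revert haj hk
  fin_cases a <;> fin_cases j <;> fin_cases a' <;> fin_cases k₁ <;> fin_cases k₂ <;> fin_cases k₃ <;> decide

/-- The orders of `(θ+1)^{k₁} (θ-2)^{k₂} (θ+2)^{k₃}` at the three primes above `5` are `k₁, k₂, k₃`. [folklore] -/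
theorem log_valuation_v₅_prod (k₁ k₂ k₃ : ℕ) :
    WithZero.log ((v₅ (Or.inl rfl : (-1 : ℤ) = -1 ∨ (-1 : ℤ) = 2 ∨ (-1 : ℤ) = -2)).valuation K
        ((θ + 1) ^ k₁ * (θ - 2) ^ k₂ * (θ + 2) ^ k₃)) = -k₁ ∧
      WithZero.log ((v₅ (Or.inr (Or.inl rfl) : (2 : ℤ) = -1 ∨ (2 : ℤ) = 2 ∨ (2 : ℤ) = -2)).valuation K
        ((θ + 1) ^ k₁ * (θ - 2) ^ k₂ * (θ + 2) ^ k₃)) = -k₂ ∧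
      WithZero.log ((v₅ (Or.inr (Or.inr rfl) : (-2 : ℤ) = -1 ∨ (-2 : ℤ) = 2 ∨ (-2 : ℤ) = -2)).valuation K
        ((θ + 1) ^ k₁ * (θ - 2) ^ k₂ * (θ + 2) ^ k₃)) = -k₃ := by
  have hc1 : (-1 : ℤ) = -1 ∨ (-1 : ℤ) = 2 ∨ (-1 : ℤ) = -2 := Or.inl rfl
  have hc2 : (2 : ℤ) = -1 ∨ (2 : ℤ) = 2 ∨ (2 : ℤ) = -2 := Or.inr (Or.inl rfl)
  have hc3 : (-2 : ℤ) = -1 ∨ (-2 : ℤ) = 2 ∨ (-2 : ℤ) = -2 := Or.inr (Or.inr rfl)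
  have hπ1 : (θ + 1 : K) = θ - ((-1 : ℤ) : K) := by push_cast; ring
  have hπ2 : (θ - 2 : K) = θ - ((2 : ℤ) : K) := by push_cast; ring
  have hπ3 : (θ + 2 : K) = θ - ((-2 : ℤ) : K) := by push_cast; ring
  have hne : ∀ {c : ℤ} (hc : c = -1 ∨ c = 2 ∨ c = -2) (v : HeightOneSpectrum (𝓞 K)), v.valuation K (θ - c) ≠ 0 :=
    fun hc v => (Valuation.ne_zero_iff _).mpr (by
      rw [← coe_θint_sub]; exact RingOfIntegers.coe_ne_zero_iff.mpr (θint_sub_ne_zero hc))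
  have key : ∀ {c : ℤ} (hc : c = -1 ∨ c = 2 ∨ c = -2),
      WithZero.log ((v₅ hc).valuation K ((θ + 1) ^ k₁ * (θ - 2) ^ k₂ * (θ + 2) ^ k₃)) =
        k₁ • WithZero.log ((v₅ hc).valuation K (θ - ((-1 : ℤ) : K))) +
          k₂ • WithZero.log ((v₅ hc).valuation K (θ - ((2 : ℤ) : K))) +
            k₃ • WithZero.log ((v₅ hc).valuation K (θ - ((-2 : ℤ) : K))) := by
    intro c hc
    rw [hπ1, hπ2, hπ3, map_mul, map_mul, map_pow, map_pow, map_pow,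
      WithZero.log_mul (mul_ne_zero (pow_ne_zero _ (hne hc1 _)) (pow_ne_zero _ (hne hc2 _))) (pow_ne_zero _ (hne hc3 _)),
      WithZero.log_mul (pow_ne_zero _ (hne hc1 _)) (pow_ne_zero _ (hne hc2 _)), WithZero.log_pow, WithZero.log_pow,
      WithZero.log_pow]
  refine ⟨?_, ?_, ?_⟩
  · rw [key hc1, log_valuation_v₅_self hc1, valuation_v₅_other hc1 hc2 (by norm_num), valuation_v₅_other hc1 hc3 (by norm_num),
      WithZero.log_one, smul_zero, smul_zero, add_zero, add_zero, smul_neg, nsmul_eq_mul, mul_one]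
  · rw [key hc2, log_valuation_v₅_self hc2, valuation_v₅_other hc2 hc1 (by norm_num), valuation_v₅_other hc2 hc3 (by norm_num),
      WithZero.log_one, smul_zero, smul_zero, zero_add, add_zero, smul_neg, nsmul_eq_mul, mul_one]
  · rw [key hc3, log_valuation_v₅_self hc3, valuation_v₅_other hc3 hc1 (by norm_num), valuation_v₅_other hc3 hc2 (by norm_num),
      WithZero.log_one, smul_zero, smul_zero, zero_add, zero_add, smul_neg, nsmul_eq_mul, mul_one]

/-- The valuation of a unit of `𝓞 K` is `1` at every finite place. [folklore] -/
theorem valuation_coe_unit (v : HeightOneSpectrum (𝓞 K)) (u : (𝓞 K)ˣ) : v.valuation K (((u : 𝓞 K)) : K) = 1 := by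
  rw [RingOfIntegers.coe_eq_algebraMap, valuation_of_algebraMap, intValuation_eq_one_iff]
  exact fun h => v.isPrime.ne_top (Ideal.eq_top_of_isUnit_mem _ h u.isUnit)

/-- **The norm-`1` `2`-descent statement for `480a1` over the cyclic cubic field of conductor `13`.**
For every `K`-point `(x, y)`, `y ≠ 0`, of `y² = x(x + 2)(x - 3)` such that `N_{K/ℚ}(x)` and
`N_{K/ℚ}(x + 2)` are rational squares, `x` and `x + 2` are squares in `K`. Proof: `x = uA²` and
`x + 2 = u'·(θ+1)^{k₁}(θ-2)^{k₂}(θ+2)^{k₃}·B²` with norm-`1` unit classes `u, u'`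
(`exists_rep_mul_sq_x`, `exists_rep_mul_prod_mul_sq_x_add_two`); the real places restrict `(u', k)`
to four possibilities (`real_survivors`); the `2`-adic obstruction kills every `u ≠ 1`
(`two_adic_obstruction` with the twelve candidates), so `x = A²`; then `x + 2 = A² + 2` has even order
at the primes above `5` (`two_dvd_log_valuation_sq_add_two`), so `k = 0`, hence `u' = 1` and
`x + 2 = B²`. [folklore] -/
theorem normDescent {x y : K} (hE : y ^ 2 = x * (x + 2) * (x - 3)) (hy : y ≠ 0)
    (hNx : IsSquare (Algebra.norm ℚ x)) (hNx2 : IsSquare (Algebra.norm ℚ (x + 2))) :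
    IsSquare x ∧ IsSquare (x + 2) := by
  obtain ⟨a, j, A, hA0, hxA⟩ := exists_rep_mul_sq_x hE hy hNx
  obtain ⟨a', j', k₁, k₂, k₃, B, hB0, -, hxB⟩ := exists_rep_mul_prod_mul_sq_x_add_two hE hy hNx2
  -- the real places
  have hsgn : sgn (rep a' a' j') * (((-1, 1, 1) : SignType × SignType × SignType) ^ (k₁ : ℕ) *
      ((-1, -1, -1) : SignType × SignType × SignType) ^ (k₂ : ℕ) *
        ((-1, 1, 1) : SignType × SignType × SignType) ^ (k₃ : ℕ)) = 1 := by
    have h := sgn3_x_add_two hE hy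
    obtain ⟨g1, g2, g3⟩ := sgn3_generators
    rw [hxB, sgn3_mul, sgn3_mul, sgn3_sq hB0, mul_one, sgn3_coe_unit, sgn3_mul, sgn3_mul, sgn3_pow, sgn3_pow,
      sgn3_pow, g1, g2, g3] at h
    exact h
  have hsurv := real_survivors a' j' k₁ k₂ k₃ hsgn
  have hj' : j' = 0 := by rcases hsurv with ⟨-, h, -⟩ | ⟨-, h, -⟩ <;> exact h
  subst hj'
  -- the `2`-adic obstruction forces `u = 1`
  obtain ⟨ψ, hψ⟩ := CubicAlg.exists_ψ₈
  have haj : a = 0 ∧ j = 0 := by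
    by_contra hne
    have hk : (a' = 0 ∧ k₂ = 0 ∧ k₁ = k₃) ∨ (a' = 1 ∧ k₂ = 1 ∧ k₁ ≠ k₃) := by
      rcases hsurv with ⟨h1, -, h2, h3⟩ | ⟨h1, -, h2, h3⟩
      · exact Or.inl ⟨h1, h2, h3⟩
      · exact Or.inr ⟨h1, h2, h3⟩
    refine two_adic_obstruction ψ (αO := ((rep a a j : (𝓞 K)ˣ) : 𝓞 K))
      (βO := ((rep a' a' 0 : (𝓞 K)ˣ) : 𝓞 K) * ((θint + 1) ^ (k₁ : ℕ) * (θint - 2) ^ (k₂ : ℕ) * (θint + 2) ^ (k₃ : ℕ)))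
      (unit_not_mem_span_two _) (rep_mul_prod_not_mem_span_two _ _ _ _) ?_ hE hy hA0 hB0 hxA ?_
    · rw [map_mul, ψ_rep ψ hψ, ψ_rep ψ hψ]
      simp only [map_mul, map_pow, map_add, map_sub, map_one, map_ofNat, hψ]
      exact mem_candidates12 a j a' k₁ k₂ k₃ hne hk
    · have hβ : ((((rep a' a' 0 : (𝓞 K)ˣ) : 𝓞 K) *
          ((θint + 1) ^ (k₁ : ℕ) * (θint - 2) ^ (k₂ : ℕ) * (θint + 2) ^ (k₃ : ℕ)) : 𝓞 K) : K) =
          (((rep a' a' 0 : (𝓞 K)ˣ) : 𝓞 K) : K) * ((θ + 1) ^ (k₁ : ℕ) * (θ - 2) ^ (k₂ : ℕ) * (θ + 2) ^ (k₃ : ℕ)) := by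
        show algebraMap (𝓞 K) K _ = algebraMap (𝓞 K) K _ * _
        rw [map_mul, map_mul, map_mul, map_pow, map_pow, map_pow, map_add, map_sub, map_add, map_ofNat, map_one,
          show algebraMap (𝓞 K) K θint = θ from rfl]
      rw [hβ]; exact hxB
  obtain ⟨rfl, rfl⟩ := haj
  have hx1 : x = A ^ 2 := by
    rw [hxA]; simp [rep]
  -- `k = 0` from the primes above `5`
  have hc1 : (-1 : ℤ) = -1 ∨ (-1 : ℤ) = 2 ∨ (-1 : ℤ) = -2 := Or.inl rfl
  have hc2 : (2 : ℤ) = -1 ∨ (2 : ℤ) = 2 ∨ (2 : ℤ) = -2 := Or.inr (Or.inl rfl)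
  have hc3 : (-2 : ℤ) = -1 ∨ (-2 : ℤ) = 2 ∨ (-2 : ℤ) = -2 := Or.inr (Or.inr rfl)
  obtain ⟨l1, l2, l3⟩ := log_valuation_v₅_prod (k₁ : ℕ) k₂ k₃
  have hP0 : ((θ + 1) ^ (k₁ : ℕ) * (θ - 2) ^ (k₂ : ℕ) * (θ + 2) ^ (k₃ : ℕ) : K) ≠ 0 := by
    intro h0; rw [h0, mul_zero, zero_mul] at hxB; exact (x_ne hE hy).2.1 hxB
  have hk : ∀ {c : ℤ} (hc : c = -1 ∨ c = 2 ∨ c = -2) {kc : Fin 2},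
      WithZero.log ((v₅ hc).valuation K ((θ + 1) ^ (k₁ : ℕ) * (θ - 2) ^ (k₂ : ℕ) * (θ + 2) ^ (k₃ : ℕ))) = -(kc : ℕ) →
        kc = 0 := by
    intro c hc kc hlog
    have h2 := two_dvd_log_valuation_sq_add_two hA0 hc
    rw [← hx1, hxB, map_mul, map_mul, map_pow, valuation_coe_unit, one_mul,
      WithZero.log_mul ((Valuation.ne_zero_iff _).mpr hP0) (pow_ne_zero _ ((Valuation.ne_zero_iff _).mpr hB0)),
      WithZero.log_pow, hlog] at h2
    have hlt := kc.isLt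
    rw [nsmul_eq_mul] at h2
    have h0 : (kc : ℕ) = 0 := by omega
    exact Fin.ext h0
  have e1 : k₁ = 0 := hk hc1 l1
  have e2 : k₂ = 0 := hk hc2 l2
  have e3 : k₃ = 0 := hk hc3 l3
  subst e1; subst e2; subst e3
  have ha' : a' = 0 := by
    rcases hsurv with ⟨h, -⟩ | ⟨-, -, h, -⟩
    · exact h
    · exact absurd h (by decide)
  subst ha'
  refine ⟨⟨A, by rw [hx1, pow_two]⟩, ⟨B, ?_⟩⟩
  rw [hxB]; simp [rep, pow_two]

end Assembly

/-! ### Transport to any cubic field generated by a root of `f` -/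

section Transport

variable {K' : Type*} [Field K'] [Algebra ℚ K']

/-- `f(z) = z³ + z² - 4z + 1` as the value of `aeval`. [folklore] -/
theorem aeval_cubicPolyRat (z : K') : aeval z cubicPolyRat = z ^ 3 + z ^ 2 - 4 * z + 1 := by
  refine (aeval_map_algebraMap ℚ z cubicPoly).trans ?_
  rw [cubicPoly, map_add, map_sub, map_add, map_pow, map_pow, map_mul, aeval_C, aeval_X, aeval_C,
    map_ofNat, map_one]

/-- **The homomorphism `K = ℚ[X]/(f) → K'`, `θ ↦ θ'`**, for a root `θ'` of `f` in a `ℚ`-algebra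
`K'`. [folklore] -/
def algHomOfRoot {θ' : K'} (h : θ' ^ 3 + θ' ^ 2 - 4 * θ' + 1 = 0) : K →ₐ[ℚ] K' :=
  AdjoinRoot.liftAlgHom cubicPolyRat (Algebra.ofId ℚ K') θ'
    (show aeval θ' cubicPolyRat = 0 by rw [aeval_cubicPolyRat, h])

/-- `algHomOfRoot h θ = θ'`. [folklore] -/
theorem algHomOfRoot_θ {θ' : K'} (h : θ' ^ 3 + θ' ^ 2 - 4 * θ' + 1 = 0) : algHomOfRoot h θ = θ' :=
  AdjoinRoot.liftAlgHom_root _ _ _ _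

/-- **`K ≃ₐ[ℚ] K'` for every cubic extension `K'/ℚ` containing a root of `f`**: the
homomorphism `θ ↦ θ'` out of the field `K` is injective, hence bijective by `[K : ℚ] = 3 = [K' : ℚ]`.
[folklore] -/
def algEquivOfRoot (h3 : Module.finrank ℚ K' = 3) {θ' : K'}
    (h : θ' ^ 3 + θ' ^ 2 - 4 * θ' + 1 = 0) : K ≃ₐ[ℚ] K' :=
  haveI : FiniteDimensional ℚ K' := Module.finite_of_finrank_eq_succ h3
  AlgEquiv.ofBijective (algHomOfRoot h)
    ⟨(algHomOfRoot h).toRingHom.injective,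
     (LinearMap.injective_iff_surjective_of_finrank_eq_finrank (f := (algHomOfRoot h).toLinearMap)
        (by rw [finrank_K, h3])).mp (algHomOfRoot h).toRingHom.injective⟩

/-- `algEquivOfRoot h3 h θ = θ'`. [folklore] -/
theorem algEquivOfRoot_θ (h3 : Module.finrank ℚ K' = 3) {θ' : K'}
    (h : θ' ^ 3 + θ' ^ 2 - 4 * θ' + 1 = 0) : algEquivOfRoot h3 h θ = θ' :=
  algHomOfRoot_θ h

/-- Squares are preserved by ring isomorphisms. [folklore] -/
theorem isSquare_map_of_isSquare (e : K ≃ₐ[ℚ] K') {z : K} (hz : IsSquare z) : IsSquare (e z) := by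
  obtain ⟨r, hr⟩ := hz
  exact ⟨e r, by rw [hr, map_mul]⟩

/-- **Transport of `normDescent` along `K ≃ₐ[ℚ] K'`** (the curve equation, the norms
`N_{·/ℚ}` and squareness are invariant under `ℚ`-algebra isomorphisms). [folklore] -/
theorem normDescent_of_algEquiv (e : K ≃ₐ[ℚ] K') {x y : K'} (hE : y ^ 2 = x * (x + 2) * (x - 3))
    (hy : y ≠ 0) (hNx : IsSquare (Algebra.norm ℚ x)) (hNx2 : IsSquare (Algebra.norm ℚ (x + 2))) :
    IsSquare x ∧ IsSquare (x + 2) := by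
  set x₀ := e.symm x with hx₀
  set y₀ := e.symm y with hy₀
  have hx : x = e x₀ := (e.apply_symm_apply x).symm
  have hyy : y = e y₀ := (e.apply_symm_apply y).symm
  have hE₀ : y₀ ^ 2 = x₀ * (x₀ + 2) * (x₀ - 3) := by
    apply e.injective
    rw [map_pow, map_mul, map_mul, map_add, map_sub, map_ofNat, map_ofNat, ← hx, ← hyy, hE]
  have hy₀' : y₀ ≠ 0 := fun h => hy (by rw [hyy, h, map_zero])
  have hN₀ : Algebra.norm ℚ x₀ = Algebra.norm ℚ x := by
    rw [hx, Algebra.norm_eq_of_algEquiv e x₀]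
  have hN₂ : Algebra.norm ℚ (x₀ + 2) = Algebra.norm ℚ (x + 2) := by
    rw [← Algebra.norm_eq_of_algEquiv e (x₀ + 2), map_add, map_ofNat, ← hx]
  obtain ⟨h1, h2⟩ := normDescent hE₀ hy₀' (hN₀ ▸ hNx) (hN₂ ▸ hNx2)
  refine ⟨hx ▸ isSquare_map_of_isSquare e h1, ?_⟩
  have : x + 2 = e (x₀ + 2) := by rw [map_add, map_ofNat, ← hx]
  rw [this]
  exact isSquare_map_of_isSquare e h2

/-- **The norm-`1` `2`-descent of `480a1` over ANY cubic extension `K'/ℚ` generated by a root of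
`f = X³ + X² - 4X + 1`** (i.e. over any copy of the cyclic cubic field of conductor `13`, in
whatever form it presents itself — e.g. as a subfield of `ℚ(ζ₁₃₃₉)`): points `(x, y)`, `y ≠ 0`, of
`y² = x(x+2)(x-3)` with `N(x)`, `N(x + 2) ∈ ℚ²` have `x`, `x + 2 ∈ K'²`. [folklore] -/
theorem normDescent_of_root (h3 : Module.finrank ℚ K' = 3) {θ' : K'}
    (hθ' : θ' ^ 3 + θ' ^ 2 - 4 * θ' + 1 = 0) {x y : K'} (hE : y ^ 2 = x * (x + 2) * (x - 3))
    (hy : y ≠ 0) (hNx : IsSquare (Algebra.norm ℚ x)) (hNx2 : IsSquare (Algebra.norm ℚ (x + 2))) :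
    IsSquare x ∧ IsSquare (x + 2) :=
  normDescent_of_algEquiv (algEquivOfRoot h3 hθ') hE hy hNx hNx2

end Transport


end CyclicCubic13

end Literature.NumberTheory.NumberFields

end
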